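import Literature.Topology.FourManifolds.HCobordismWallTrickEven
import Literature.Topology.FourManifolds.TwistedSphereFilling
import Literature.Topology.FourManifolds.LatticeFormsEichlerFramesOdd
import Literature.Topology.FourManifolds.LatticeFormsCharacteristicParity
import Literature.Topology.FourManifolds.StabilisationCobordismKronecker
import HarnessLib

/-!
# Wall's Theorem 2 for ODD forms from the realisation of Kirby's generators of one summand — WALL'S TRICK without the generation theorem and without a realised `ℂP²`-conjugation

Topic `Literature/Topology/FourManifolds`; fact seat of
`Literature.Topology.FourManifolds.isHCobordant_of_equivalent_intersectionForm` (**Wall 1964,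
Thm. 2**: two simply connected closed smooth 4-manifolds with isomorphic quadratic forms are
h-cobordant; C. T. C. Wall, *On simply-connected 4-manifolds*, J. London Math. Soc. 39 (1964),
§2 pp. 144–146; R. C. Kirby, *The topology of 4-manifolds*, LNM 1374 (1989), Ch. X).  Sequel of
`HCobordismWallTrickEven.lean` (all EVEN forms from (R) + Thom + the even spin-bordism step).

THE ODD CASE.  For `Q⟦μ⟧ ≅ Q⟦ν⟧` odd of rank `n = m + 2 ≥ 2`, Wall's §2 assembly is run over the
odd core-free model `P = T # (m+1)(S² × S²)`, `T = S² ×~ S²` the twisted surgery of `𝕊⁴`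
(`TwistedSphereFilling.lean`: `T` bounds the simply connected `V_T = 𝔻⁵ ∪` twisted 2-handle,
`H²(T)/T` has a basis of Gram matrix `!![0,1;1,1]` whose isotropic vector `e` detects the classes
dying in `V_T`), with the filling `V = V_T ∪ E` (`E` the cobordism of `m + 1` trivially attached
2-handles with its Kronecker data, `exists_stabilisationCobordism_kronecker`), the detector
`π₀ = (⟨βⱼ, ·⟩ⱼ, ⟨Θ(e, 0), ·⟩)`, the Lagrangian `L = span {Θ(e,0), βⱼ}` and an h-cobordism
`N′ = M # (−N) ∼ P` from (R) + Thom (`Q_{N′} ≅ ⟨1⟩ ⊕ ⟨-1⟩ ⊕ (m+1)·H` HAS a hyperbolic pair).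
Two new phenomena, both handled WITHOUT new diffeomorphisms:

* the MOVER (`exists_wordMover_odd`): the words in Kirby's generators of the last summand
  carry a Lagrangian direct summand `K` of `H²(P)/T` onto `L` OR onto its twin
  `L̃ = span {Θ(ẽ, 0), βⱼ}` (`ẽ` the other primitive isotropic direction of the core
  `⟨1⟩ ⊕ ⟨-1⟩`): Wall's lemma `T(K) = L`, the FULL-FRAME-ODD transport of
  `LatticeFormsEichlerFramesOdd.lean` applied to the hyperbolic part of the frame of `L`, and the
  observation that the image of the odd vector is isotropic and orthogonal to the placed
  half-frame, hence `±e` or `±ẽ` modulo the `βⱼ`;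
* the DICHOTOMY (`exists_graphMover_odd`): the conclusion of Wall's theorem does not depend on
  the isometry, and the graphs of `α` and of `α ∘ τ` (`τ` the reflection in a vector of norm `±1`
  of `Q⟦ν⟧`) lie in different mod-4 classes of the parity invariant of characteristic isotropic
  vectors, which words in Kirby's generators preserve (`LatticeFormsCharacteristicParity.lean`);
  so if both graphs were carried onto the wrong twin, a word would relate them — contradiction.
  The filling theorem with the graph mover (`isHCobordant_of_wallFilling_of_graphMover`) closes.

Main results: `isHCobordant_of_not_isEven_of_oddModel` (the assembly over an abstract odd
model), `isHCobordant_of_equivalent_intersectionForm_of_not_isEven_of_realisedWallGenerators'`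
— **Wall's Theorem 2 for ODD forms of rank `≥ 2` whose form represents `1` or `-1` (all odd
indefinite forms, `±I_n`; the Akhmedov–Park form `⟨1⟩ ⊕ 2⟨-1⟩`), from (R) + Thom's theorem
alone** — no hyperbolic pair in `Q⟦μ⟧`, no generation theorem for `O(Q ⊕ H)`, no realised complex
conjugation; and `…_of_not_isEven_of_thmX2'` (from Thm. X.2 + Thom).  The only local instance is a
priority bump of Mathlib's `Prod.instModule` inside one section (so that `Basis.prod`,
`LinearMap.coprod` and type-class inference agree on the `ℤ`-module structure of a product).

Everything is proved; no named fact is introduced (D-0026).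

## References

* C. T. C. Wall, *On simply-connected 4-manifolds*, J. London Math. Soc. 39 (1964) 141–149,
  Thm. 2, §2 pp. 144–146. [WallJLMS1964]
* R. C. Kirby, *The topology of 4-manifolds*, LNM 1374 (1989), Ch. X, proofs of Thm. 1
  (pp. 55–56) and Thm. 2 (pp. 58, 61–62). [Kirby1989]
-/

noncomputable section

open scoped Manifold ContDiff Topology
open Set Function Module CategoryTheory CategoryTheory.Limits
open Literature.AlgebraicTopology.SingularHomology Literature.AlgebraicTopology.Homotopy
open LinearMap (BilinForm)

namespace Literature.Topology.FourManifolds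

/-- Local notation: `𝔼 n` is the model Euclidean space `EuclideanSpace ℝ (Fin n)`. -/
local notation "𝔼 " n:arg => EuclideanSpace ℝ (Fin n)

/-- Local notation: `𝕊 n` is the unit sphere in `EuclideanSpace ℝ (Fin (n + 1))`. -/
local notation "𝕊 " n:arg => (Metric.sphere (0 : EuclideanSpace ℝ (Fin (n + 1))) 1)

/-- Local notation: `Q⟦μ⟧` is the intersection form on `H²(·; ℤ)/T`. -/
local notation "Q⟦" μ "⟧" =>
  Literature.AlgebraicTopology.SingularHomology.intersectionForm two_add_two_eq_four μ

/-! ### Stabilisations of any closed simply connected 4-manifold exist -/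

/-- **Every closed simply connected smooth 4-manifold `X₀` has a `k`-fold stabilisation
`X₀ # k(S² × S²)`, again closed and simply connected** (the top end of the trace on a standard
chart, `StdChart.isConnectedSum_top`, iterated). [cite: Kirby1989, Ch. X, proof of Thm. 1, p. 55] -/
theorem exists_isStabilization (k : ℕ) (X₀ : Type) [TopologicalSpace X₀] [T2Space X₀]
    [SecondCountableTopology X₀] [ChartedSpace (𝔼 4) X₀] [CompactSpace X₀] [IsManifold (𝓡 4) ∞ X₀]
    [SimplyConnectedSpace X₀] :
    ∃ (P : Type) (_ : TopologicalSpace P) (_ : T2Space P) (_ : SecondCountableTopology P)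
      (_ : ChartedSpace (𝔼 4) P) (_ : CompactSpace P) (_ : IsManifold (𝓡 4) ∞ P)
      (_ : SimplyConnectedSpace P), IsStabilization k X₀ P := by
  induction k with
  | zero =>
    exact ⟨X₀, inferInstance, inferInstance, inferInstance, inferInstance, inferInstance,
      inferInstance, inferInstance, (isStabilization_zero_iff X₀ X₀).2 ⟨Diffeomorph.refl (𝓡 4) X₀ ∞⟩⟩
  | succ k ih =>
    obtain ⟨P, _, _, _, _, _, _, _, hP⟩ := ih
    obtain ⟨C, -, -⟩ := StdChart.exists_mem_source (Classical.arbitrary P)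
    have hP' : IsStabilization (k + 1) X₀ C.Top := hP.succ C.isConnectedSum_top
    obtain ⟨hsc, hc, hsnd, -⟩ := exists_stabilisationCobordism (k + 1) X₀ C.Top hP'
    exact ⟨C.Top, inferInstance, inferInstance, hsnd, inferInstance, hc, inferInstance, hsc, hP'⟩

/-! ### Bases indexed by a sum: complementary spans, ranks, Kronecker duals -/

section SumBases

variable {R : Type*} [CommRing R] {W : Type*} [AddCommGroup W] [Module R W] {ι κ : Type*}

/-- The spans of the two parts of a basis indexed by `ι ⊕ κ` are complementary. [folklore] -/
theorem isCompl_span_sum (b : Basis (ι ⊕ κ) R W) :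
    IsCompl (Submodule.span R (Set.range (b ∘ Sum.inl))) (Submodule.span R (Set.range (b ∘ Sum.inr))) := by
  have h1 : Set.range (b ∘ Sum.inl) = b '' Set.range Sum.inl := by rw [Set.range_comp]
  have h2 : Set.range (b ∘ Sum.inr) = b '' (Set.range Sum.inl)ᶜ := by
    rw [Set.range_comp, Set.compl_range_inl]
  rw [h1, h2]
  refine ⟨b.linearIndependent.disjoint_span_image disjoint_compl_right, ?_⟩
  rw [codisjoint_iff, ← Submodule.span_union, ← Set.image_union, Set.union_compl_self,
    Set.image_univ, b.span_eq]

end SumBases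

/-- The span of the `ι`-part of a `ℤ`-basis indexed by `ι ⊕ κ` has rank `|ι|`. [folklore] -/
theorem finrank_span_sumInl {W : Type*} [AddCommGroup W] [Module ℤ W] {ι κ : Type*} [Fintype ι]
    (b : Basis (ι ⊕ κ) ℤ W) :
    finrank ℤ (Submodule.span ℤ (Set.range (b ∘ Sum.inl))) = Fintype.card ι := by
  have h := finrank_span_eq_card (R := ℤ) (b.linearIndependent.comp Sum.inl Sum.inl_injective)
  convert h using 2
  exact Subsingleton.elim _ _

/-- **Kronecker duals of coordinates**: for a basis `bP` of `H²(P)/T` indexed by `ι ⊕ κ` and the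
perfect Kronecker pairing of the closed simply connected `P`, a class pairing to zero with every
homology class killed by all `⟨bP (inl i), ·⟩` lies in the span of the `bP (inl i)` (test against
the homology classes dual to the coordinates `inr j`). [folklore] -/
theorem mem_span_sumInl_of_forall_kronecker {P : Type} [TopologicalSpace P] [CompactSpace P]
    [T2Space P] [ChartedSpace (𝔼 4) P] [SimplyConnectedSpace P] {ι κ : Type*}
    (bP : Basis (ι ⊕ κ) ℤ ↥(freeCohomology ℤ P 2)) (c : ↥(freeCohomology ℤ P 2))
    (hc : ∀ y : singularHomology ℤ ℤ P 2,
      (∀ i, freeKroneckerPairing P 2 (bP (Sum.inl i)) y = 0) → freeKroneckerPairing P 2 c y = 0) :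
    c ∈ Submodule.span ℤ (Set.range (bP ∘ Sum.inl)) := by
  classical
  haveI := isPerfPair_freeKroneckerPairing_two P
  have hcoord : ∀ j, bP.repr c (Sum.inr j) = 0 := by
    intro j
    obtain ⟨y, hy⟩ := (LinearMap.IsPerfPair.bijective_right (freeKroneckerPairing P 2)).2
      (bP.coord (Sum.inr j))
    have hy' : ∀ c', freeKroneckerPairing P 2 c' y = bP.repr c' (Sum.inr j) := fun c' => by
      have h := LinearMap.congr_fun hy c'
      simpa only [LinearMap.flip_apply, Basis.coord_apply] using h
    rw [← hy']
    refine hc y fun i => ?_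
    rw [hy', Basis.repr_self, Finsupp.single_apply, if_neg Sum.inl_ne_inr]
  rw [Set.range_comp, Basis.mem_span_image]
  intro i hi
  rcases i with i | j
  · exact ⟨i, rfl⟩
  · exact absurd (hcoord j) (Finsupp.mem_support_iff.1 hi)

/-! ### The lattice of a stabilisation `P = X # k(S² × S²)` from the stabilisation data and a basis of `H²(X)/T` -/

section CoreBasis

/- `Module ℤ` on a product: make Mathlib's `Prod.instModule` (used by `Basis.prod`,
`LinearMap.coprod`) the preferred instance locally, over `AddCommGroup.toIntModule`. -/
attribute [local instance 1100] Prod.instModule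

/-- **A basis of `H²(P)/T` adapted to the stabilisation data**: from
`Θ : H²(X)/T ⊕ (ℤ²)ᵏ ≅ H²(P)/T` and a basis `bX` of `H²(X)/T`, the basis
`(Θ(bX i, 0))_i ⊔ (βⱼ = Θ(0, eⱼ ⊗ (1,0)))ⱼ ⊔ (β′ⱼ = Θ(0, eⱼ ⊗ (0,1)))ⱼ`.
[cite: Kirby1989, Ch. X, proof of Thm. 1, pp. 55–56] -/
theorem exists_coreBasis_of_stabilisationData {X P : Type} [TopologicalSpace X] [TopologicalSpace P]
    {k : ℕ} (Θ : (↥(freeCohomology ℤ X 2) × (Fin k → Fin 2 → ℤ)) ≃+ ↥(freeCohomology ℤ P 2))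
    {ι : Type*} (bX : Basis ι ℤ ↥(freeCohomology ℤ X 2)) :
    ∃ bP : Basis (ι ⊕ (Fin k ⊕ Fin k)) ℤ ↥(freeCohomology ℤ P 2),
      (∀ i, bP (Sum.inl i) = Θ (bX i, 0)) ∧
      (∀ j, bP (Sum.inr (Sum.inl j)) = Θ (0, Pi.single j (Pi.single 0 1))) ∧
      (∀ j, bP (Sum.inr (Sum.inr j)) = Θ (0, Pi.single j (Pi.single 1 1))) := by
  -- the partial maps `x ↦ Θ (x, 0)`, `c ↦ Θ (0, c)` and their coproduct (which is `Θ`)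
  let fX : ↥(freeCohomology ℤ X 2) →ₗ[ℤ] ↥(freeCohomology ℤ P 2) :=
    { toFun := fun x => Θ (x, 0)
      map_add' := fun x x' => by rw [← map_add, Prod.mk_add_mk, add_zero]
      map_smul' := fun n x => by
        have h := map_intCast_smul Θ.toAddMonoidHom ℤ ℤ n ((x, (0 : Fin k → Fin 2 → ℤ)))
        simp only [Int.cast_id, AddEquiv.coe_toAddMonoidHom, Prod.smul_mk, smul_zero] at h
        simpa only [RingHom.id_apply] using h }
  have hfX : ∀ x, fX x = Θ (x, 0) := fun x => rfl
  let f₀ : (Fin k → Fin 2 → ℤ) →ₗ[ℤ] ↥(freeCohomology ℤ P 2) :=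
    { toFun := fun c => Θ (0, c)
      map_add' := fun c c' => by rw [← map_add, Prod.mk_add_mk, add_zero]
      map_smul' := fun n c => by
        have h := map_intCast_smul Θ.toAddMonoidHom ℤ ℤ n (((0 : ↥(freeCohomology ℤ X 2)), c))
        simp only [Int.cast_id, AddEquiv.coe_toAddMonoidHom, Prod.smul_mk, smul_zero] at h
        simpa only [RingHom.id_apply] using h }
  have hf₀ : ∀ c, f₀ c = Θ (0, c) := fun c => rfl
  have hco : ∀ p, fX.coprod f₀ p = Θ p := fun p => by
    rw [LinearMap.coprod_apply, hfX, hf₀, ← map_add, Prod.mk_add_mk, add_zero, zero_add]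
  have hbij : Function.Bijective (fX.coprod f₀) :=
    ⟨fun p q h => Θ.injective (by rwa [hco, hco] at h),
      fun y => ⟨Θ.symm y, by rw [hco, AddEquiv.apply_symm_apply]⟩⟩
  let e := LinearEquiv.ofBijective (fX.coprod f₀) hbij
  have he : ∀ p, e p = Θ p := fun p => by rw [LinearEquiv.ofBijective_apply, hco]
  obtain ⟨b₀, hb₀l, hb₀r⟩ := exists_modelBasis k
  refine ⟨(bX.prod b₀).map e, fun i => ?_, fun j => ?_, fun j => ?_⟩
  · rw [Basis.map_apply, he, Basis.prod_apply, Sum.elim_inl, Function.comp_apply, LinearMap.inl_apply]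
  · rw [Basis.map_apply, he, Basis.prod_apply, Sum.elim_inr, Function.comp_apply, LinearMap.inr_apply,
      hb₀l]
  · rw [Basis.map_apply, he, Basis.prod_apply, Sum.elim_inr, Function.comp_apply, LinearMap.inr_apply,
      hb₀r]

end CoreBasis

/-! ### Expansion in a core-hyperbolic basis -/

section CoreHyperbolic

variable {R : Type*} [CommRing R] {W : Type*} [AddCommGroup W] [Module R W] {B : BilinForm R W} {k : ℕ}

/-- **Expansion of a vector orthogonal to the `βⱼ` in a core-hyperbolic basis**: for a
non-degenerate symmetric `B` (`B : W → Dual W` one-to-one) with a basis `e, f, βⱼ, β′ⱼ` of Gram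
matrix `!![0,1;1,1] ⊕ k·H` (core orthogonal to the planes), every `v` with `v·βⱼ = 0` for all `j`
is `(v·f − v·e) e + (v·e) f + Σⱼ (v·β′ⱼ) βⱼ`.  Any commutative ring of scalars. [folklore] -/
theorem eq_expansion_of_ortho_beta (hB : B.IsSymm) (hinj : Function.Injective B)
    (b : Basis ((Unit ⊕ Fin k) ⊕ (Unit ⊕ Fin k)) R W)
    (hee : B (b (Sum.inl (Sum.inl PUnit.unit))) (b (Sum.inl (Sum.inl PUnit.unit))) = 0)
    (hef : B (b (Sum.inl (Sum.inl PUnit.unit))) (b (Sum.inr (Sum.inl PUnit.unit))) = 1)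
    (hff : B (b (Sum.inr (Sum.inl PUnit.unit))) (b (Sum.inr (Sum.inl PUnit.unit))) = 1)
    (heβ : ∀ j, B (b (Sum.inl (Sum.inl PUnit.unit))) (b (Sum.inl (Sum.inr j))) = 0)
    (heβ' : ∀ j, B (b (Sum.inl (Sum.inl PUnit.unit))) (b (Sum.inr (Sum.inr j))) = 0)
    (hfβ : ∀ j, B (b (Sum.inr (Sum.inl PUnit.unit))) (b (Sum.inl (Sum.inr j))) = 0)
    (hfβ' : ∀ j, B (b (Sum.inr (Sum.inl PUnit.unit))) (b (Sum.inr (Sum.inr j))) = 0)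
    (hββ : ∀ i j, B (b (Sum.inl (Sum.inr i))) (b (Sum.inl (Sum.inr j))) = 0)
    (hββ' : ∀ i j, B (b (Sum.inl (Sum.inr i))) (b (Sum.inr (Sum.inr j))) = if i = j then 1 else 0)
    {v : W} (hv : ∀ j, B v (b (Sum.inl (Sum.inr j))) = 0) :
    v = (B v (b (Sum.inr (Sum.inl PUnit.unit))) - B v (b (Sum.inl (Sum.inl PUnit.unit)))) • b (Sum.inl (Sum.inl PUnit.unit)) +
      B v (b (Sum.inl (Sum.inl PUnit.unit))) • b (Sum.inr (Sum.inl PUnit.unit)) +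
      ∑ j, B v (b (Sum.inr (Sum.inr j))) • b (Sum.inl (Sum.inr j)) := by
  -- test against every basis vector
  rw [← sub_eq_zero]
  apply hinj
  rw [map_zero]
  refine b.ext fun idx => ?_
  have hsumβ : ∀ w, B (∑ j, B v (b (Sum.inr (Sum.inr j))) • b (Sum.inl (Sum.inr j))) w =
      ∑ j, B v (b (Sum.inr (Sum.inr j))) * B (b (Sum.inl (Sum.inr j))) w := fun w => by
    rw [LinearMap.BilinForm.sum_left]
    exact Finset.sum_congr rfl fun j _ => by rw [LinearMap.BilinForm.smul_left]
  rw [LinearMap.zero_apply, map_sub, LinearMap.sub_apply, map_add, map_add, LinearMap.add_apply,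
    LinearMap.add_apply, LinearMap.BilinForm.smul_left, LinearMap.BilinForm.smul_left, hsumβ]
  rcases idx with (⟨⟩ | j) | (⟨⟩ | j)
  · rw [hee, hB.eq (b (Sum.inr (Sum.inl PUnit.unit))) (b (Sum.inl (Sum.inl PUnit.unit))), hef,
      Finset.sum_eq_zero fun j _ => by rw [hB.eq _ (b (Sum.inl (Sum.inl PUnit.unit))), heβ, mul_zero]]
    ring
  · rw [heβ, hfβ, Finset.sum_eq_zero fun i _ => by rw [hββ, mul_zero], hv]
    ring
  · rw [hef, hff,
      Finset.sum_eq_zero fun j _ => by rw [hB.eq _ (b (Sum.inr (Sum.inl PUnit.unit))), hfβ, mul_zero]]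
    ring
  · rw [heβ', hfβ', Finset.sum_eq_single j]
    · rw [hββ', if_pos rfl]; ring
    · intro i _ hij; rw [hββ', if_neg hij, mul_zero]
    · intro h; exact absurd (Finset.mem_univ j) h

/-- A complemented submodule of a torsion-free module is saturated: `n • x ∈ S`, `n ≠ 0` forces
`x ∈ S`. [folklore] -/
theorem mem_of_smul_mem_of_isCompl [IsCancelMulZero R] [Module.IsTorsionFree R W] {S S' : Submodule R W}
    (hc : IsCompl S S') {n : R} (hn : n ≠ 0) {x : W} (hx : n • x ∈ S) : x ∈ S := by
  have hx' : x ∈ S ⊔ S' := by rw [hc.sup_eq_top]; exact Submodule.mem_top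
  obtain ⟨y, hy, z, hz, rfl⟩ := Submodule.mem_sup.1 hx'
  have hz' : n • z ∈ S ⊓ S' := by
    refine ⟨?_, S'.smul_mem n hz⟩
    have h : n • z = n • (y + z) - n • y := by rw [smul_add]; abel
    rw [h]
    exact S.sub_mem hx (S.smul_mem n hy)
  rw [hc.inf_eq_bot, Submodule.mem_bot, smul_eq_zero] at hz'
  rcases hz' with h | h
  · exact absurd h hn
  · rw [h, add_zero]; exact hy

end CoreHyperbolic

/-! ### The two Lagrangians through the `βⱼ`: `span {e, βⱼ}` and its twin `span {f + f - e, βⱼ}` -/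

section Twin

variable {W : Type*} [AddCommGroup W] [inst : Module ℤ W] {B : BilinForm ℤ W} {k : ℕ}

/-- Changing the inserted generator by an element of the span does not change the span. [folklore] -/
theorem span_insert_eq_span_insert_of_sub_mem {R : Type*} [Ring R] {M : Type*} [AddCommGroup M]
    [Module R M] {v c : M} {s : Set M} (h : v - c ∈ Submodule.span R s) :
    Submodule.span R (insert v s) = Submodule.span R (insert c s) := by
  apply le_antisymm
  · rw [Submodule.span_le, Set.insert_subset_iff]
    refine ⟨?_, Set.Subset.trans (Set.subset_insert c s) Submodule.subset_span⟩
    have hv : v = c + (v - c) := by abel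
    rw [hv]
    exact Submodule.add_mem _ (Submodule.subset_span (Set.mem_insert c s))
      (Submodule.span_mono (Set.subset_insert c s) h)
  · rw [Submodule.span_le, Set.insert_subset_iff]
    refine ⟨?_, Set.Subset.trans (Set.subset_insert v s) Submodule.subset_span⟩
    have hc : c = v - (v - c) := by abel
    rw [hc]
    exact Submodule.sub_mem _ (Submodule.subset_span (Set.mem_insert v s))
      (Submodule.span_mono (Set.subset_insert v s) h)

/-- **A complemented Lagrangian through the `βⱼ` is `span {e, βⱼ}` or its twin
`span {f + f - e, βⱼ}`**: in a unimodular lattice with a core-hyperbolic basis (`e, f` with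
Gram `!![0,1;1,1]`, planes `(βⱼ, β′ⱼ)`), an isotropic `v` orthogonal to the `βⱼ` is
`a e + b f + Σ tⱼ βⱼ` with `b (2a + b) = 0`, so — if `span {v, βⱼ}` is complemented of rank
`k + 1` — it is `span {e, βⱼ}` (`b = 0`, `a = ±1` by saturation) or `span {f + f - e, βⱼ}`
(`b = -2a`).  Any `ℤ`-module structure. [cite: WallJLMS1964, §2, p. 145] -/
theorem span_insert_eq_or_twin [Module.Free ℤ W] [Module.Finite ℤ W] (hB : B.IsSymm) (hU : B.IsUnimodular)
    (b : Basis ((Unit ⊕ Fin k) ⊕ (Unit ⊕ Fin k)) ℤ W)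
    (hee : B (b (Sum.inl (Sum.inl PUnit.unit))) (b (Sum.inl (Sum.inl PUnit.unit))) = 0)
    (hef : B (b (Sum.inl (Sum.inl PUnit.unit))) (b (Sum.inr (Sum.inl PUnit.unit))) = 1)
    (hff : B (b (Sum.inr (Sum.inl PUnit.unit))) (b (Sum.inr (Sum.inl PUnit.unit))) = 1)
    (heβ : ∀ j, B (b (Sum.inl (Sum.inl PUnit.unit))) (b (Sum.inl (Sum.inr j))) = 0)
    (heβ' : ∀ j, B (b (Sum.inl (Sum.inl PUnit.unit))) (b (Sum.inr (Sum.inr j))) = 0)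
    (hfβ : ∀ j, B (b (Sum.inr (Sum.inl PUnit.unit))) (b (Sum.inl (Sum.inr j))) = 0)
    (hfβ' : ∀ j, B (b (Sum.inr (Sum.inl PUnit.unit))) (b (Sum.inr (Sum.inr j))) = 0)
    (hββ : ∀ i j, B (b (Sum.inl (Sum.inr i))) (b (Sum.inl (Sum.inr j))) = 0)
    (hββ' : ∀ i j, B (b (Sum.inl (Sum.inr i))) (b (Sum.inr (Sum.inr j))) = if i = j then 1 else 0)
    {v : W} (hv : ∀ j, B v (b (Sum.inl (Sum.inr j))) = 0) (hvv : B v v = 0)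
    (hc : ∃ S'' : Submodule ℤ W, IsCompl (Submodule.span ℤ (insert v (Set.range fun j => b (Sum.inl (Sum.inr j))))) S'')
    (hr : finrank ℤ (Submodule.span ℤ (insert v (Set.range fun j => b (Sum.inl (Sum.inr j))))) = k + 1) :
    Submodule.span ℤ (insert v (Set.range fun j => b (Sum.inl (Sum.inr j)))) =
        Submodule.span ℤ (insert (b (Sum.inl (Sum.inl PUnit.unit))) (Set.range fun j => b (Sum.inl (Sum.inr j)))) ∨
      Submodule.span ℤ (insert v (Set.range fun j => b (Sum.inl (Sum.inr j)))) =
        Submodule.span ℤ (insert (b (Sum.inr (Sum.inl PUnit.unit)) + b (Sum.inr (Sum.inl PUnit.unit)) - b (Sum.inl (Sum.inl PUnit.unit)))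
          (Set.range fun j => b (Sum.inl (Sum.inr j)))) := by
  obtain rfl : inst = AddCommGroup.toIntModule W := Subsingleton.elim _ _
  classical
  haveI : B.IsPerfPair := hU
  have hinj : Function.Injective B := (LinearMap.IsPerfPair.bijective_left B).1
  set e := b (Sum.inl (Sum.inl PUnit.unit)) with he
  set f := b (Sum.inr (Sum.inl PUnit.unit)) with hf
  set β : Fin k → W := fun j => b (Sum.inl (Sum.inr j)) with hβdef
  set Sβ := Submodule.span ℤ (Set.range β) with hSβ
  set a := B v f - B v e with ha
  set c := B v e with hcdef
  -- the expansion of `v`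
  have hexp := eq_expansion_of_ortho_beta hB hinj b hee hef hff heβ heβ' hfβ hfβ' hββ hββ' hv
  rw [← he, ← hf, ← ha, ← hcdef] at hexp
  have hsum_mem : (∑ j, B v (b (Sum.inr (Sum.inr j))) • b (Sum.inl (Sum.inr j))) ∈ Sβ :=
    Submodule.sum_mem _ fun j _ => Submodule.smul_mem _ _ (Submodule.subset_span ⟨j, rfl⟩)
  -- `v·v = 2ac + c² = c (2a + c)`
  have hvf : B v f = a + c := by rw [ha, hcdef]; ring
  have hvβ_sum : B v (∑ j, B v (b (Sum.inr (Sum.inr j))) • b (Sum.inl (Sum.inr j))) = 0 := by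
    rw [map_sum]
    exact Finset.sum_eq_zero fun j _ => by rw [map_smul, smul_eq_mul, hv, mul_zero]
  have hquad : c * (2 * a + c) = 0 := by
    have h : B v (a • e + c • f + ∑ j, B v (b (Sum.inr (Sum.inr j))) • b (Sum.inl (Sum.inr j))) =
        a * B v e + c * B v f := by
      rw [map_add, map_add, hvβ_sum, add_zero, map_smul, map_smul, smul_eq_mul, smul_eq_mul]
    rw [← hexp, hvv, ← hcdef, hvf] at h
    linear_combination -h
  -- the rank of `Sβ` is `k`
  have hSβr : finrank ℤ Sβ = k := by
    have hli : LinearIndependent ℤ β :=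
      b.linearIndependent.comp (fun j => Sum.inl (Sum.inr j))
        (fun i j hij => by simpa using hij)
    have h := finrank_span_eq_card (R := ℤ) hli
    rw [Fintype.card_fin] at h
    exact h
  -- a generator `g` with `span {g, β} = span {v, β}` and `n • g = w` forces, by saturation and rank, `w`-versions
  have hsat : ∀ {x : W} {n : ℤ}, n ≠ 0 →
      n • x ∈ Submodule.span ℤ (insert v (Set.range β)) → x ∈ Submodule.span ℤ (insert v (Set.range β)) := by
    intro x n hn hx
    obtain ⟨S'', hcS⟩ := hc
    exact mem_of_smul_mem_of_isCompl hcS hn hx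
  have hne : Submodule.span ℤ (insert v (Set.range β)) ≠ Sβ := by
    intro h
    have h' := hr
    rw [h, hSβr] at h'
    omega
  -- the key step: if `v ≡ n • g (mod Sβ)` then `n ≠ 0`, `g ∈ span {v, β}` and the spans agree
  have hkey : ∀ (g : W) (n : ℤ), v - n • g ∈ Sβ →
      Submodule.span ℤ (insert v (Set.range β)) = Submodule.span ℤ (insert g (Set.range β)) := by
    intro g n hvg
    have h1 : Submodule.span ℤ (insert v (Set.range β)) = Submodule.span ℤ (insert (n • g) (Set.range β)) :=
      span_insert_eq_span_insert_of_sub_mem hvg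
    have hn : n ≠ 0 := by
      rintro rfl
      apply hne
      rw [h1, zero_smul, hSβ]
      apply le_antisymm
      · rw [Submodule.span_le, Set.insert_subset_iff]
        exact ⟨Submodule.zero_mem _, Submodule.subset_span⟩
      · exact Submodule.span_mono (Set.subset_insert _ _)
    have hg : g ∈ Submodule.span ℤ (insert v (Set.range β)) := by
      refine hsat hn ?_
      rw [h1]
      exact Submodule.subset_span (Set.mem_insert _ _)
    apply le_antisymm
    · rw [h1, Submodule.span_le, Set.insert_subset_iff]
      refine ⟨Submodule.smul_mem _ _ (Submodule.subset_span (Set.mem_insert _ _)),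
        Set.Subset.trans (Set.subset_insert _ _) Submodule.subset_span⟩
    · rw [Submodule.span_le, Set.insert_subset_iff]
      exact ⟨hg, Set.Subset.trans (Set.subset_insert _ _) Submodule.subset_span⟩
  rcases mul_eq_zero.1 hquad with h0 | h0
  · -- `c = 0`: `v = a e + Σ`, the span is `span {e, β}`
    left
    refine hkey e a ?_
    rw [h0, zero_smul, add_zero] at hexp
    rw [show v - a • e = ∑ j, B v (b (Sum.inr (Sum.inr j))) • b (Sum.inl (Sum.inr j)) by
      nth_rw 1 [hexp]; abel]
    exact hsum_mem
  · -- `c = -2a`: `v = -a (f + f - e) + Σ`, the span is the twin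
    right
    refine hkey (f + f - e) (-a) ?_
    have hc2 : c = -2 * a := by linear_combination h0
    rw [show v - -a • (f + f - e) = ∑ j, B v (b (Sum.inr (Sum.inr j))) • b (Sum.inl (Sum.inr j)) by
      conv_lhs => rw [hexp, hc2]
      module]
    exact hsum_mem

end Twin

/-! ### Isotropic spans, the first half of a core-hyperbolic basis, block form of its Gram matrix -/

section CoreGram

variable {R : Type*} [CommRing R] {W : Type*} [AddCommGroup W] [Module R W] {B : BilinForm R W} {k : ℕ}

/-- A form vanishing on `s × s` vanishes on `span s × span s`. [folklore] -/
theorem isotropic_span_of_forall (B : BilinForm R W) {s : Set W} (hs : ∀ x ∈ s, ∀ y ∈ s, B x y = 0) :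
    ∀ x ∈ Submodule.span R s, ∀ y ∈ Submodule.span R s, B x y = 0 := by
  intro x hx y hy
  refine Submodule.span_induction (p := fun y _ => B x y = 0) ?_ ?_ ?_ ?_ hy
  · intro c hc
    refine Submodule.span_induction (p := fun x _ => B x c = 0) ?_ ?_ ?_ ?_ hx
    · intro a ha
      exact hs a ha c hc
    · rw [map_zero, LinearMap.zero_apply]
    · intro a a' _ _ ha ha'
      rw [map_add, LinearMap.add_apply, ha, ha', add_zero]
    · intro r a _ ha
      rw [LinearMap.BilinForm.smul_left, ha, mul_zero]
  · rw [map_zero]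
  · intro a a' _ _ ha ha'
    rw [map_add, ha, ha', add_zero]
  · intro r a _ ha
    rw [LinearMap.BilinForm.smul_right, ha, mul_zero]

/-- The range of the first half of a family indexed by `(Unit ⊕ Fin k) ⊕ κ` is `{e} ∪ {βⱼ}`.
[folklore] -/
theorem range_comp_inl_eq_insert {κ α : Type*} (b : (Unit ⊕ Fin k) ⊕ κ → α) :
    Set.range (b ∘ Sum.inl) =
      insert (b (Sum.inl (Sum.inl PUnit.unit))) (Set.range fun j => b (Sum.inl (Sum.inr j))) := by
  ext x
  simp only [Set.mem_range, Set.mem_insert_iff, Function.comp_apply]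
  constructor
  · rintro ⟨(⟨⟩ | j), rfl⟩
    · exact Or.inl rfl
    · exact Or.inr ⟨j, rfl⟩
  · rintro (rfl | ⟨j, rfl⟩)
    · exact ⟨Sum.inl (), rfl⟩
    · exact ⟨Sum.inr j, rfl⟩

/-- **Block form of a core-hyperbolic Gram matrix**: the ten Gram equations of a basis
`e, βⱼ ⊔ f, β′ⱼ` (`!![0,1;1,1] ⊕ k·H`) as three block formulas indexed by `Unit ⊕ Fin k`.
[folklore] -/
theorem coreGram_blocks (hB : B.IsSymm) (b : Basis ((Unit ⊕ Fin k) ⊕ (Unit ⊕ Fin k)) R W)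
    (hee : B (b (Sum.inl (Sum.inl PUnit.unit))) (b (Sum.inl (Sum.inl PUnit.unit))) = 0)
    (hef : B (b (Sum.inl (Sum.inl PUnit.unit))) (b (Sum.inr (Sum.inl PUnit.unit))) = 1)
    (hff : B (b (Sum.inr (Sum.inl PUnit.unit))) (b (Sum.inr (Sum.inl PUnit.unit))) = 1)
    (heβ : ∀ j, B (b (Sum.inl (Sum.inl PUnit.unit))) (b (Sum.inl (Sum.inr j))) = 0)
    (heβ' : ∀ j, B (b (Sum.inl (Sum.inl PUnit.unit))) (b (Sum.inr (Sum.inr j))) = 0)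
    (hfβ : ∀ j, B (b (Sum.inr (Sum.inl PUnit.unit))) (b (Sum.inl (Sum.inr j))) = 0)
    (hfβ' : ∀ j, B (b (Sum.inr (Sum.inl PUnit.unit))) (b (Sum.inr (Sum.inr j))) = 0)
    (hββ : ∀ i j, B (b (Sum.inl (Sum.inr i))) (b (Sum.inl (Sum.inr j))) = 0)
    (hβ'β' : ∀ i j, B (b (Sum.inr (Sum.inr i))) (b (Sum.inr (Sum.inr j))) = 0)
    (hββ' : ∀ i j, B (b (Sum.inl (Sum.inr i))) (b (Sum.inr (Sum.inr j))) = if i = j then 1 else 0) :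
    (∀ a c, B (b (Sum.inl a)) (b (Sum.inl c)) = 0) ∧
    (∀ a c, B (b (Sum.inl a)) (b (Sum.inr c)) = if a = c then 1 else 0) ∧
    (∀ a c, B (b (Sum.inr a)) (b (Sum.inr c)) = if a = c ∧ a = Sum.inl PUnit.unit then 1 else 0) := by
  refine ⟨?_, ?_, ?_⟩
  · rintro (⟨⟩ | i) (⟨⟩ | j)
    · exact hee
    · exact heβ j
    · rw [hB.eq]; exact heβ i
    · exact hββ i j
  · rintro (⟨⟩ | i) (⟨⟩ | j)
    · rw [if_pos rfl]; exact hef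
    · rw [if_neg Sum.inl_ne_inr]; exact heβ' j
    · rw [if_neg Sum.inr_ne_inl, hB.eq]; exact hfβ i
    · rw [hββ']
      by_cases h : i = j
      · rw [if_pos h, if_pos (congrArg Sum.inr h)]
      · rw [if_neg h, if_neg (fun h' => h (Sum.inr_injective h'))]
  · rintro (⟨⟩ | i) (⟨⟩ | j)
    · rw [if_pos ⟨rfl, rfl⟩]; exact hff
    · rw [if_neg (fun h => Sum.inl_ne_inr h.1)]; exact hfβ' j
    · rw [if_neg (fun h => Sum.inr_ne_inl h.1), hB.eq]; exact hfβ' i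
    · rw [if_neg (fun h => Sum.inr_ne_inl h.2)]; exact hβ'β' i j

/-- The first half `e, βⱼ` of a core-hyperbolic basis spans an isotropic submodule. [folklore] -/
theorem isotropic_span_inl_of_coreGram (hB : B.IsSymm) (b : Basis ((Unit ⊕ Fin k) ⊕ (Unit ⊕ Fin k)) R W)
    (hee : B (b (Sum.inl (Sum.inl PUnit.unit))) (b (Sum.inl (Sum.inl PUnit.unit))) = 0)
    (heβ : ∀ j, B (b (Sum.inl (Sum.inl PUnit.unit))) (b (Sum.inl (Sum.inr j))) = 0)
    (hββ : ∀ i j, B (b (Sum.inl (Sum.inr i))) (b (Sum.inl (Sum.inr j))) = 0) :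
    ∀ x ∈ Submodule.span R (Set.range (b ∘ Sum.inl)), ∀ y ∈ Submodule.span R (Set.range (b ∘ Sum.inl)),
      B x y = 0 := by
  refine isotropic_span_of_forall B ?_
  rintro _ ⟨a, rfl⟩ _ ⟨c, rfl⟩
  rcases a with ⟨⟩ | i <;> rcases c with ⟨⟩ | j
  · exact hee
  · exact heβ j
  · rw [Function.comp_apply, Function.comp_apply, hB.eq]; exact heβ i
  · exact hββ i j

end CoreGram

/-! ### The lattice of `N = M₁ # (−M₂)` for odd `Q`: `Q ⊥ (−Q) ≅ !![0,1;1,1] ⊕ (m+1)·H`, with a hyperbolic pair -/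

section ConnectedSumLatticeOdd

/-- **`Q ⊥ (−Q) ≅ !![0,1;1,1] ⊕ k·H` for odd unimodular `Q` of rank `k + 1`, explicitly**: if the
lattice `H²(N)/T` of a closed `ℤ`-oriented `N` splits as `H²(M₁)/T ⊕ H²(M₂)/T` with
`Q_N = Q⟦μ⟧ ⊕ (−Q⟦ν⟧)`, `Q⟦μ⟧ ≅ Q⟦ν⟧` (isometry `α`) and `Q⟦μ⟧` odd, then `Q_N` is isometric to
every lattice with a core-hyperbolic basis indexed by `(Unit ⊕ Fin k) ⊕ (Unit ⊕ Fin k)` (Gram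
`!![0,1;1,1] ⊕ k·H`, e.g. `H²(P)/T` for `P = S² ×~ S² # k(S² × S²)`), and (for `k ≥ 1`) `Q_N`
contains a hyperbolic pair.  Proof: the graph of `α` is a Lagrangian direct summand of half rank
(`graphSubmodule_lagrangian`, Wall p. 144), `Q_N` is odd (`Q_N (x, 0) (x, 0) = Q x x`), so Wall's
normal form (`Lagrangian.exists_normalForm`) has `o = some i₀`; reindex so that `i₀` becomes the
core index, and compare Gram matrices (`exists_isometryEquiv_of_basis_gram_eq`).
[cite: WallJLMS1964, §2 pp. 144–145] -/
theorem exists_isometryEquiv_of_splitting_of_not_isEven {M₁ M₂ N W : Type} [TopologicalSpace M₁]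
    [TopologicalSpace M₂] [TopologicalSpace N] [CompactSpace N] [T2Space N] [ChartedSpace (𝔼 4) N]
    [SimplyConnectedSpace N]
    (μ : HomologicalOrientation ℤ M₁ 4) (ν : HomologicalOrientation ℤ M₂ 4)
    (π : HomologicalOrientation ℤ N 4)
    [Module.Free ℤ ↥(freeCohomology ℤ M₁ 2)] [Module.Finite ℤ ↥(freeCohomology ℤ M₁ 2)]
    [Module.Free ℤ ↥(freeCohomology ℤ M₂ 2)] [Module.Finite ℤ ↥(freeCohomology ℤ M₂ 2)]
    {sM : ↥(freeCohomology ℤ N 2) →ₗ[ℤ] ↥(freeCohomology ℤ M₁ 2)}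
    {sN : ↥(freeCohomology ℤ N 2) →ₗ[ℤ] ↥(freeCohomology ℤ M₂ 2)}
    (hst : Function.Bijective fun x => (sM x, sN x))
    (hQ : ∀ x y, Q⟦π⟧ x y = Q⟦μ⟧ (sM x) (sM y) - Q⟦ν⟧ (sN x) (sN y))
    (α : (Q⟦μ⟧).IsometryEquiv (Q⟦ν⟧)) (hodd : ¬ (Q⟦μ⟧).IsEven)
    [AddCommGroup W] [Module ℤ W] {B : BilinForm ℤ W} (hBsymm : B.IsSymm) {k : ℕ}
    (hk : finrank ℤ ↥(freeCohomology ℤ M₁ 2) = k + 1)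
    (bP : Basis ((Unit ⊕ Fin k) ⊕ (Unit ⊕ Fin k)) ℤ W)
    (hee : B (bP (Sum.inl (Sum.inl PUnit.unit))) (bP (Sum.inl (Sum.inl PUnit.unit))) = 0)
    (hef : B (bP (Sum.inl (Sum.inl PUnit.unit))) (bP (Sum.inr (Sum.inl PUnit.unit))) = 1)
    (hff : B (bP (Sum.inr (Sum.inl PUnit.unit))) (bP (Sum.inr (Sum.inl PUnit.unit))) = 1)
    (heβ : ∀ j, B (bP (Sum.inl (Sum.inl PUnit.unit))) (bP (Sum.inl (Sum.inr j))) = 0)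
    (heβ' : ∀ j, B (bP (Sum.inl (Sum.inl PUnit.unit))) (bP (Sum.inr (Sum.inr j))) = 0)
    (hfβ : ∀ j, B (bP (Sum.inr (Sum.inl PUnit.unit))) (bP (Sum.inl (Sum.inr j))) = 0)
    (hfβ' : ∀ j, B (bP (Sum.inr (Sum.inl PUnit.unit))) (bP (Sum.inr (Sum.inr j))) = 0)
    (hββ : ∀ i j, B (bP (Sum.inl (Sum.inr i))) (bP (Sum.inl (Sum.inr j))) = 0)
    (hβ'β' : ∀ i j, B (bP (Sum.inr (Sum.inr i))) (bP (Sum.inr (Sum.inr j))) = 0)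
    (hββ' : ∀ i j, B (bP (Sum.inl (Sum.inr i))) (bP (Sum.inr (Sum.inr j))) = if i = j then 1 else 0) :
    Nonempty ((Q⟦π⟧).IsometryEquiv B) ∧ ¬ (Q⟦π⟧).IsEven ∧
      (0 < k → ∃ e f : ↥(freeCohomology ℤ N 2), Q⟦π⟧ e e = 0 ∧ Q⟦π⟧ f f = 0 ∧ Q⟦π⟧ e f = 1) := by
  classical
  -- the lattice of `N`: finitely generated free, `Q_N` symmetric unimodular odd
  obtain ⟨hfinN, hfreeN⟩ := finite_and_free_freeCohomology_two (M := N)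
  haveI := hfinN
  haveI := hfreeN
  have hsymm : (Q⟦π⟧).IsSymm :=
    isSymm_intersectionForm (cupProduct_gradedComm_holds ℤ N) even_two two_add_two_eq_four π
  have hU : (Q⟦π⟧).IsUnimodular := isPerfPair_intersectionForm_four_of_compactSpace (M := N) π
  have hoddN : ¬ (Q⟦π⟧).IsEven := by
    intro hev
    apply hodd
    intro x
    obtain ⟨y, hy⟩ := hst.2 (x, 0)
    have hy1 : sM y = x := congrArg Prod.fst hy
    have hy2 : sN y = 0 := congrArg Prod.snd hy
    have h := hev y
    rw [hQ, hy1, hy2] at h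
    simpa only [map_zero, LinearMap.zero_apply, sub_zero] using h
  -- the graph of `α`: a Lagrangian direct summand of half rank, of rank `k + 1`
  obtain ⟨⟨K', hc⟩, hKi, hKr⟩ := graphSubmodule_lagrangian hst hQ α
  have hrankN : finrank ℤ ↥(freeCohomology ℤ N 2) =
      finrank ℤ ↥(freeCohomology ℤ M₁ 2) + finrank ℤ ↥(freeCohomology ℤ M₂ 2) := by
    letI : Module ℤ (↥(freeCohomology ℤ M₁ 2) × ↥(freeCohomology ℤ M₂ 2)) := Prod.instModule
    have e := (LinearEquiv.ofBijective (sM.prod sN) hst).finrank_eq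
    rw [Module.finrank_prod] at e
    exact e
  have hrank₂ : finrank ℤ ↥(freeCohomology ℤ M₂ 2) = finrank ℤ ↥(freeCohomology ℤ M₁ 2) :=
    α.toLinearEquiv.finrank_eq.symm
  have hKk : finrank ℤ ↥(graphSubmodule sM sN (α : _ →ₗ[ℤ] _)) = k + 1 := by omega
  -- Wall's normal form, with its odd index `i₀`
  obtain ⟨b, o, hbspan, hbdual, ho, hG⟩ := Lagrangian.exists_normalForm_of_module hsymm hU hc hKi hKr
  have ho' : o ≠ none := fun h => hoddN (ho.1 h)
  obtain ⟨i₀, hi₀⟩ := Option.ne_none_iff_exists'.1 ho'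
  subst hi₀
  have hbl : ∀ i j, Q⟦π⟧ (b (Sum.inl i)) (b (Sum.inl j)) = 0 := fun i j =>
    hKi _ (hbspan.le (Submodule.subset_span ⟨i, rfl⟩)) _ (hbspan.le (Submodule.subset_span ⟨j, rfl⟩))
  -- reindex so that `i₀` becomes the core index `inl ()`
  let σ : Fin (finrank ℤ ↥(graphSubmodule sM sN (α : _ →ₗ[ℤ] _))) ≃ Unit ⊕ Fin k :=
    ((finCongr hKk).trans (finSuccEquiv' (finCongr hKk i₀))).trans
      ((Equiv.optionEquivSumPUnit (Fin k)).trans (Equiv.sumComm (Fin k) Unit))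
  have hσ : σ i₀ = Sum.inl PUnit.unit := by
    simp [σ]
  have key : ∀ a, some i₀ = some (σ.symm a) ↔ a = Sum.inl PUnit.unit := fun a => by
    rw [Option.some_inj, eq_comm, Equiv.symm_apply_eq, hσ]
  set b' := b.reindex (Equiv.sumCongr σ σ) with hb'
  have hb'l : ∀ a, b' (Sum.inl a) = b (Sum.inl (σ.symm a)) := fun a => by
    rw [hb', Basis.reindex_apply]; rfl
  have hb'r : ∀ a, b' (Sum.inr a) = b (Sum.inr (σ.symm a)) := fun a => by
    rw [hb', Basis.reindex_apply]; rfl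
  obtain ⟨hLL, hLR, hRR⟩ := coreGram_blocks hBsymm bP hee hef hff heβ heβ' hfβ hfβ' hββ hβ'β' hββ'
  have hG' : ∀ a c, Q⟦π⟧ (b' a) (b' c) = B (bP a) (bP c) := by
    rintro (a | a) (c | c)
    · rw [hb'l, hb'l, hbl, hLL]
    · rw [hb'l, hb'r, hbdual, hLR]
      simp only [Equiv.apply_eq_iff_eq]
    · rw [hb'r, hb'l, hsymm.eq, hbdual, hBsymm.eq, hLR]
      simp only [Equiv.apply_eq_iff_eq]
    · rw [hb'r, hb'r, hG, hRR]
      simp only [Equiv.apply_eq_iff_eq, key]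
  obtain ⟨T, -⟩ := exists_isometryEquiv_of_basis_gram_eq b' bP hG'
  refine ⟨⟨T⟩, hoddN, fun hkpos => ?_⟩
  refine ⟨b (Sum.inl (σ.symm (Sum.inr ⟨0, hkpos⟩))), b (Sum.inr (σ.symm (Sum.inr ⟨0, hkpos⟩))),
    hbl _ _, ?_, ?_⟩
  · rw [hG, if_neg]
    rintro ⟨-, h⟩
    exact Sum.inr_ne_inl ((key _).1 h)
  · rw [hbdual, if_pos rfl]

end ConnectedSumLatticeOdd

/-! ### The core-hyperbolic basis of `H²(P)/T` for `P = T # k(S² × S²)`, `Q_T ≅ !![0,1;1,1]` -/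

section OddCoreBasis

/-- **The core-hyperbolic basis of `H²(P)/T`** for `P` a `k`-fold stabilisation of `T` with
identification `Θ : H²(T)/T ⊕ (ℤ²)ᵏ ≅ H²(P)/T`, form law `Q_P = Q_T ⊕ k·H` and a basis
`(bT 0, bT 1)` of `H²(T)/T` of Gram matrix `!![0,1;1,1]`: the basis
`e = Θ(bT 0, 0), βⱼ = Θ(0, eⱼ ⊗ (1,0)) ⊔ f = Θ(bT 1, 0), β′ⱼ = Θ(0, eⱼ ⊗ (0,1))`, indexed by
`(Unit ⊕ Fin k) ⊕ (Unit ⊕ Fin k)`, with its ten Gram equations.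
[cite: Kirby1989, Ch. X, proof of Thm. 1, pp. 55–56] [cite: WallJLMS1964, §2, p. 145] -/
theorem exists_oddCoreBasis {T P : Type} [TopologicalSpace T] [TopologicalSpace P] {k : ℕ}
    (μP : HomologicalOrientation ℤ P 4) (μT : HomologicalOrientation ℤ T 4)
    (Θ : (↥(freeCohomology ℤ T 2) × (Fin k → Fin 2 → ℤ)) ≃+ ↥(freeCohomology ℤ P 2))
    (hform : ∀ x y, Q⟦μP⟧ (Θ x) (Θ y) = Q⟦μT⟧ x.1 y.1 + ∑ j, hyperbolicForm (x.2 j) (y.2 j))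
    (bT : Basis (Fin 2) ℤ ↥(freeCohomology ℤ T 2))
    (hT00 : Q⟦μT⟧ (bT 0) (bT 0) = 0) (hT01 : Q⟦μT⟧ (bT 0) (bT 1) = 1)
    (hT11 : Q⟦μT⟧ (bT 1) (bT 1) = 1) :
    ∃ bP : Basis ((Unit ⊕ Fin k) ⊕ (Unit ⊕ Fin k)) ℤ ↥(freeCohomology ℤ P 2),
      Q⟦μP⟧ (bP (Sum.inl (Sum.inl PUnit.unit))) (bP (Sum.inl (Sum.inl PUnit.unit))) = 0 ∧
      Q⟦μP⟧ (bP (Sum.inl (Sum.inl PUnit.unit))) (bP (Sum.inr (Sum.inl PUnit.unit))) = 1 ∧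
      Q⟦μP⟧ (bP (Sum.inr (Sum.inl PUnit.unit))) (bP (Sum.inr (Sum.inl PUnit.unit))) = 1 ∧
      (∀ j, Q⟦μP⟧ (bP (Sum.inl (Sum.inl PUnit.unit))) (bP (Sum.inl (Sum.inr j))) = 0) ∧
      (∀ j, Q⟦μP⟧ (bP (Sum.inl (Sum.inl PUnit.unit))) (bP (Sum.inr (Sum.inr j))) = 0) ∧
      (∀ j, Q⟦μP⟧ (bP (Sum.inr (Sum.inl PUnit.unit))) (bP (Sum.inl (Sum.inr j))) = 0) ∧
      (∀ j, Q⟦μP⟧ (bP (Sum.inr (Sum.inl PUnit.unit))) (bP (Sum.inr (Sum.inr j))) = 0) ∧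
      (∀ i j, Q⟦μP⟧ (bP (Sum.inl (Sum.inr i))) (bP (Sum.inl (Sum.inr j))) = 0) ∧
      (∀ i j, Q⟦μP⟧ (bP (Sum.inr (Sum.inr i))) (bP (Sum.inr (Sum.inr j))) = 0) ∧
      (∀ i j, Q⟦μP⟧ (bP (Sum.inl (Sum.inr i))) (bP (Sum.inr (Sum.inr j))) = if i = j then 1 else 0) ∧
      (∀ u, bP (Sum.inl (Sum.inl u)) = Θ (bT 0, 0)) ∧
      (∀ j, bP (Sum.inl (Sum.inr j)) = Θ (0, Pi.single j (Pi.single 0 1))) := by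
  classical
  obtain ⟨b₀P, hb1, hb2, hb3⟩ := exists_coreBasis_of_stabilisationData Θ bT
  -- reindex `Fin 2 ⊕ (Fin k ⊕ Fin k)` to `(Unit ⊕ Fin k) ⊕ (Unit ⊕ Fin k)`
  let σ : ((Unit ⊕ Fin k) ⊕ (Unit ⊕ Fin k)) ≃ (Fin 2 ⊕ (Fin k ⊕ Fin k)) :=
    { toFun := Sum.elim (Sum.elim (fun _ => Sum.inl 0) fun j => Sum.inr (Sum.inl j))
        (Sum.elim (fun _ => Sum.inl 1) fun j => Sum.inr (Sum.inr j))
      invFun := Sum.elim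
        (fun i => if i = 0 then Sum.inl (Sum.inl PUnit.unit) else Sum.inr (Sum.inl PUnit.unit))
        (Sum.elim (fun j => Sum.inl (Sum.inr j)) fun j => Sum.inr (Sum.inr j))
      left_inv := by
        rintro ((⟨⟩ | j) | (⟨⟩ | j)) <;> simp
      right_inv := by
        rintro (i | (j | j))
        · rcases Fin.exists_fin_two.1 ⟨i, rfl⟩ with h | h <;> simp [h]
        · simp
        · simp }
  have hσ1 : ∀ u, σ (Sum.inl (Sum.inl u)) = Sum.inl 0 := fun _ => rfl
  have hσ2 : ∀ j, σ (Sum.inl (Sum.inr j)) = Sum.inr (Sum.inl j) := fun _ => rfl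
  have hσ3 : ∀ u, σ (Sum.inr (Sum.inl u)) = Sum.inl 1 := fun _ => rfl
  have hσ4 : ∀ j, σ (Sum.inr (Sum.inr j)) = Sum.inr (Sum.inr j) := fun _ => rfl
  set bP := b₀P.reindex σ.symm with hbP
  have he : ∀ u, bP (Sum.inl (Sum.inl u)) = Θ (bT 0, 0) := fun u => by
    rw [hbP, Basis.reindex_apply, Equiv.symm_symm, hσ1, hb1]
  have hβ : ∀ j, bP (Sum.inl (Sum.inr j)) = Θ (0, Pi.single j (Pi.single 0 1)) := fun j => by
    rw [hbP, Basis.reindex_apply, Equiv.symm_symm, hσ2, hb2]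
  have hf : ∀ u, bP (Sum.inr (Sum.inl u)) = Θ (bT 1, 0) := fun u => by
    rw [hbP, Basis.reindex_apply, Equiv.symm_symm, hσ3, hb1]
  have hβ' : ∀ j, bP (Sum.inr (Sum.inr j)) = Θ (0, Pi.single j (Pi.single 1 1)) := fun j => by
    rw [hbP, Basis.reindex_apply, Equiv.symm_symm, hσ4, hb3]
  -- the Gram matrix from the form law
  have hcore : ∀ a a' : ↥(freeCohomology ℤ T 2), Q⟦μP⟧ (Θ (a, 0)) (Θ (a', 0)) = Q⟦μT⟧ a a' :=
    fun a a' => by rw [hform]; simp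
  have hmix : ∀ (a : ↥(freeCohomology ℤ T 2)) (c : Fin k → Fin 2 → ℤ),
      Q⟦μP⟧ (Θ (a, 0)) (Θ (0, c)) = 0 := fun a c => by rw [hform]; simp
  have hplanes : ∀ (a c : Fin 2) (i j : Fin k),
      Q⟦μP⟧ (Θ (0, Pi.single i (Pi.single a 1))) (Θ (0, Pi.single j (Pi.single c 1))) =
        if i = j then hyperbolicForm (Pi.single a 1 : Fin 2 → ℤ) (Pi.single c 1) else 0 := by
    intro a c i j
    rw [hform, sum_hyperbolicForm_single_single]
    simp
  refine ⟨bP, ?_, ?_, ?_, fun j => ?_, fun j => ?_, fun j => ?_, fun j => ?_, fun i j => ?_,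
    fun i j => ?_, fun i j => ?_, he, hβ⟩
  · rw [he, hcore, hT00]
  · rw [he, hf, hcore, hT01]
  · rw [hf, hcore, hT11]
  · rw [he, hβ, hmix]
  · rw [he, hβ', hmix]
  · rw [hf, hβ, hmix]
  · rw [hf, hβ', hmix]
  · rw [hβ, hβ, hplanes, hyperbolicForm_single_zero_self, ite_self]
  · rw [hβ', hβ', hplanes, hyperbolicForm_single_one_self, ite_self]
  · rw [hβ, hβ', hplanes, hyperbolicForm_single_zero_single_one]

end OddCoreBasis

/-! ### The odd Lagrangian mover: a word in Kirby's generators and its diffeomorphism carry `K` onto `L` or its twin -/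

section WordMover

variable {P : Type} [TopologicalSpace P] [T2Space P] [ChartedSpace (𝔼 4) P] [CompactSpace P]

/-- **The odd Lagrangian mover** (Wall 1964 §2 p. 145, adapted to an odd core).  In the lattice
`H²(P)/T` with a core-hyperbolic basis `bP` (`e, βⱼ ⊔ f, β′ⱼ`, Gram `!![0,1;1,1] ⊕ (m+1)·H`) and
an identification `Θ : Q ⊕ H ≅ Q_P` whose conjugated Kirby generators are realised by
diffeomorphisms (the conclusion of (R)), with target data in `Q ⊕ H` (`m` hyperbolic planes
`xs, ys` inside `Q`, the core `pV, qV` of norms `1, -1`, all together with `H` exhausting the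
lattice), every Lagrangian direct summand `K` is carried by the diffeomorphism of a WORD `φ` in the
generators onto `L = span {e, βⱼ}` or onto its twin `span {f + f - e, βⱼ}`: Wall's lemma gives an
isometry `T` with `T(K) = L`; the hyperbolic `(m+1)`-frame `(T⁻¹ βⱼ; T⁻¹ β′ⱼ)` of `K`, pulled
back along `Θ`, is transported by the full-frame-odd transport
(`exists_isWordIn_wallGenerators_apply_eq_of_fullFrame_odd`) so that the realised `g = Θ φ Θ⁻¹`
(`isRealisedByDiffeomorph_conj_of_isWordIn`) satisfies `g^*(T⁻¹ βⱼ) = βⱼ`; the remaining generator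
`v = g^*(T⁻¹ e)` of `g^*(K)` is isotropic and orthogonal to the `βⱼ`, and `span_insert_eq_or_twin`
concludes. [cite: WallJLMS1964, §2, p. 145] [cite: Kirby1989, Ch. X, proof of Thm. 2 (pp. 61–62)] -/
theorem exists_wordMover_odd {V : Type} [AddCommGroup V] {Q : BilinForm ℤ V} (hQ : Q.IsSymm)
    {m : ℕ} {xs ys : Fin m → V × (Fin 2 → ℤ)}
    (hxx : ∀ i j, Q.prod hyperbolicForm (xs i) (xs j) = 0)
    (hyy : ∀ i j, Q.prod hyperbolicForm (ys i) (ys j) = 0)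
    (hxy : ∀ i j, Q.prod hyperbolicForm (xs i) (ys j) = if i = j then 1 else 0)
    (hxX : ∀ j, Q.prod hyperbolicForm (xs j) hypX = 0) (hxY : ∀ j, Q.prod hyperbolicForm (xs j) hypY = 0)
    (hyX : ∀ j, Q.prod hyperbolicForm (ys j) hypX = 0) (hyY : ∀ j, Q.prod hyperbolicForm (ys j) hypY = 0)
    {pV qV : V} (hpp : Q pV pV = 1) (hqq : Q qV qV = -1) (hpq : Q pV qV = 0)
    (hpx : ∀ j, Q.prod hyperbolicForm ((pV, 0) : V × (Fin 2 → ℤ)) (xs j) = 0)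
    (hpy : ∀ j, Q.prod hyperbolicForm ((pV, 0) : V × (Fin 2 → ℤ)) (ys j) = 0)
    (hqx : ∀ j, Q.prod hyperbolicForm ((qV, 0) : V × (Fin 2 → ℤ)) (xs j) = 0)
    (hqy : ∀ j, Q.prod hyperbolicForm ((qV, 0) : V × (Fin 2 → ℤ)) (ys j) = 0)
    (hspan : ∀ v : V × (Fin 2 → ℤ), (∀ j, Q.prod hyperbolicForm v (xs j) = 0) →
      (∀ j, Q.prod hyperbolicForm v (ys j) = 0) → Q.prod hyperbolicForm v hypX = 0 →
      Q.prod hyperbolicForm v hypY = 0 → Q.prod hyperbolicForm v ((pV, 0) : V × (Fin 2 → ℤ)) = 0 →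
      Q.prod hyperbolicForm v ((qV, 0) : V × (Fin 2 → ℤ)) = 0 → v = 0)
    (μP : HomologicalOrientation ℤ P 4) (Θ : (Q.prod hyperbolicForm).IsometryEquiv (Q⟦μP⟧))
    (hSΘ : ∀ s ∈ wallGenerators hQ, IsRealisedByDiffeomorph μP (Θ.symm.trans (s.trans Θ)))
    (bP : Basis ((Unit ⊕ Fin (m + 1)) ⊕ (Unit ⊕ Fin (m + 1))) ℤ ↥(freeCohomology ℤ P 2))
    (hee : Q⟦μP⟧ (bP (Sum.inl (Sum.inl PUnit.unit))) (bP (Sum.inl (Sum.inl PUnit.unit))) = 0)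
    (hef : Q⟦μP⟧ (bP (Sum.inl (Sum.inl PUnit.unit))) (bP (Sum.inr (Sum.inl PUnit.unit))) = 1)
    (hff : Q⟦μP⟧ (bP (Sum.inr (Sum.inl PUnit.unit))) (bP (Sum.inr (Sum.inl PUnit.unit))) = 1)
    (heβ : ∀ j, Q⟦μP⟧ (bP (Sum.inl (Sum.inl PUnit.unit))) (bP (Sum.inl (Sum.inr j))) = 0)
    (heβ' : ∀ j, Q⟦μP⟧ (bP (Sum.inl (Sum.inl PUnit.unit))) (bP (Sum.inr (Sum.inr j))) = 0)
    (hfβ : ∀ j, Q⟦μP⟧ (bP (Sum.inr (Sum.inl PUnit.unit))) (bP (Sum.inl (Sum.inr j))) = 0)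
    (hfβ' : ∀ j, Q⟦μP⟧ (bP (Sum.inr (Sum.inl PUnit.unit))) (bP (Sum.inr (Sum.inr j))) = 0)
    (hββ : ∀ i j, Q⟦μP⟧ (bP (Sum.inl (Sum.inr i))) (bP (Sum.inl (Sum.inr j))) = 0)
    (hβ'β' : ∀ i j, Q⟦μP⟧ (bP (Sum.inr (Sum.inr i))) (bP (Sum.inr (Sum.inr j))) = 0)
    (hββ' : ∀ i j, Q⟦μP⟧ (bP (Sum.inl (Sum.inr i))) (bP (Sum.inr (Sum.inr j))) = if i = j then 1 else 0)
    (K : Submodule ℤ ↥(freeCohomology ℤ P 2))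
    (hKc : ∃ K' : Submodule ℤ ↥(freeCohomology ℤ P 2), IsCompl K K')
    (hKi : ∀ x ∈ K, ∀ y ∈ K, Q⟦μP⟧ x y = 0)
    (hKr : 2 * finrank ℤ K = finrank ℤ ↥(freeCohomology ℤ P 2)) :
    ∃ (φ : (Q.prod hyperbolicForm).IsometryEquiv (Q.prod hyperbolicForm)) (g : P ≃ₘ⟮𝓡 4, 𝓡 4⟯ P),
      IsWordIn (wallGenerators hQ) φ ∧
      (∀ x, freeCohomology.map (R := ℤ) (⟨g, g.continuous⟩ : C(P, P)) 2 x = Θ (φ (Θ.symm x))) ∧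
      (Submodule.map (freeCohomology.map (R := ℤ) (⟨g, g.continuous⟩ : C(P, P)) 2) K =
          Submodule.span ℤ (Set.range (bP ∘ Sum.inl)) ∨
        Submodule.map (freeCohomology.map (R := ℤ) (⟨g, g.continuous⟩ : C(P, P)) 2) K =
          Submodule.span ℤ (insert (bP (Sum.inr (Sum.inl PUnit.unit)) + bP (Sum.inr (Sum.inl PUnit.unit)) -
            bP (Sum.inl (Sum.inl PUnit.unit))) (Set.range fun j => bP (Sum.inl (Sum.inr j))))) := by
  classical
  -- the lattice of `P`
  obtain ⟨hfinP, hfreeP⟩ := finite_and_free_freeCohomology_two (M := P)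
  haveI := hfinP
  haveI := hfreeP
  have hsymmP : (Q⟦μP⟧).IsSymm :=
    isSymm_intersectionForm (cupProduct_gradedComm_holds ℤ P) even_two two_add_two_eq_four μP
  have hUP : (Q⟦μP⟧).IsUnimodular := isPerfPair_intersectionForm_four_of_compactSpace (M := P) μP
  -- `L = span {e, βⱼ}` is a Lagrangian direct summand of half rank
  have hLc : ∃ L' : Submodule ℤ ↥(freeCohomology ℤ P 2),
      IsCompl (Submodule.span ℤ (Set.range (bP ∘ Sum.inl))) L' := ⟨_, isCompl_span_sum bP⟩
  have hLi := isotropic_span_inl_of_coreGram hsymmP bP hee heβ hββ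
  have hrankP : finrank ℤ ↥(freeCohomology ℤ P 2) = 2 * (m + 2) := by
    rw [finrank_eq_card_basis bP]
    simp only [Fintype.card_sum, Fintype.card_unit, Fintype.card_fin]
    ring
  have hLr : 2 * finrank ℤ (Submodule.span ℤ (Set.range (bP ∘ Sum.inl))) =
      finrank ℤ ↥(freeCohomology ℤ P 2) := by
    rw [finrank_span_sumInl bP, hrankP]
    simp only [Fintype.card_sum, Fintype.card_unit, Fintype.card_fin]
    ring
  -- Wall's lemma: `T(K) = L`
  obtain ⟨T, hT⟩ := exists_isometryEquiv_map_eq_of_isotropic hsymmP hUP hKc hKi hKr hLc hLi hLr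
  -- the hyperbolic `(m+1)`-frame `(T⁻¹ βⱼ; T⁻¹ β′ⱼ)` of `K`, pulled back along `Θ`, and `A = Θ⁻¹ T Θ`
  set A : (Q.prod hyperbolicForm).IsometryEquiv (Q.prod hyperbolicForm) := Θ.trans (T.trans Θ.symm)
    with hA
  set u : Fin (m + 1) → V × (Fin 2 → ℤ) := fun l => Θ.symm (T.symm (bP (Sum.inl (Sum.inr l))))
    with hu₀
  set u' : Fin (m + 1) → V × (Fin 2 → ℤ) := fun l => Θ.symm (T.symm (bP (Sum.inr (Sum.inr l))))
    with hu₀'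
  have hu : ∀ i j, Q.prod hyperbolicForm (u i) (u j) = 0 := fun i j => by
    rw [hu₀, Θ.symm.map_app, T.symm.map_app, hββ]
  have hu' : ∀ i j, Q.prod hyperbolicForm (u' i) (u' j) = 0 := fun i j => by
    rw [hu₀', Θ.symm.map_app, T.symm.map_app, hβ'β']
  have huu' : ∀ i j, Q.prod hyperbolicForm (u i) (u' j) = if i = j then 1 else 0 := fun i j => by
    rw [hu₀, hu₀', Θ.symm.map_app, T.symm.map_app, hββ']
  obtain ⟨φ, hφ, hφu⟩ := exists_isWordIn_wallGenerators_apply_eq_of_fullFrame_odd hQ hxx hyy hxy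
    hxX hxY hyX hyY hpp hqq hpq hpx hpy hqx hqy hspan A u u' hu hu' huu'
  -- the diffeomorphism realising `Θ φ Θ⁻¹`
  obtain ⟨gd, hgd⟩ := isRealisedByDiffeomorph_conj_of_isWordIn μP hQ Θ hSΘ hφ
  have hgd' : ∀ x, freeCohomology.map (R := ℤ) (⟨gd, gd.continuous⟩ : C(P, P)) 2 x =
      Θ (φ (Θ.symm x)) := fun x => by
    rw [hgd, LinearMap.BilinForm.IsometryEquiv.trans_apply,
      LinearMap.BilinForm.IsometryEquiv.trans_apply]
  obtain ⟨G, hGdef⟩ : ∃ G : ↥(freeCohomology ℤ P 2) →ₗ[ℤ] ↥(freeCohomology ℤ P 2),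
      G = freeCohomology.map (R := ℤ) (⟨gd, gd.continuous⟩ : C(P, P)) 2 := ⟨_, rfl⟩
  have hG : ∀ x, G x = Θ (φ (Θ.symm x)) := fun x => by rw [hGdef]; exact hgd' x
  -- `G (T⁻¹ βⱼ) = βⱼ`
  have hGb : ∀ l, G (T.symm (bP (Sum.inl (Sum.inr l)))) = bP (Sum.inl (Sum.inr l)) := fun l => by
    rw [hG]
    change Θ (φ (u l)) = _
    rw [hφu, hA, LinearMap.BilinForm.IsometryEquiv.trans_apply,
      LinearMap.BilinForm.IsometryEquiv.trans_apply, hu₀]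
    simp only [LinearMap.BilinForm.IsometryEquiv.apply_symm_apply]
  -- `G` is an isometry of `Q⟦μP⟧` and a bijection
  have hGiso : ∀ x y, Q⟦μP⟧ (G x) (G y) = Q⟦μP⟧ x y := fun x y => by
    rw [hG, hG, Θ.map_app, φ.map_app, Θ.symm.map_app]
  have hGiso1 : ∀ x y, Q⟦μP⟧ (G x) (G y) = 1 * Q⟦μP⟧ x y := fun x y => by rw [hGiso, one_mul]
  have hGfun : (⇑G : _ → _) = fun x => Θ (φ (Θ.symm x)) := funext hG
  have hGbij : Function.Bijective G := by
    rw [hGfun]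
    exact Θ.toLinearEquiv.bijective.comp (φ.toLinearEquiv.bijective.comp Θ.symm.toLinearEquiv.bijective)
  -- `K = T⁻¹ L`, so `G(K) = span {v, βⱼ}` with `v = G (T⁻¹ e)`
  have hK : K = Submodule.map (T.symm.toLinearEquiv : _ →ₗ[ℤ] _)
      (Submodule.span ℤ (Set.range (bP ∘ Sum.inl))) := by
    rw [← hT, ← Submodule.map_comp]
    conv_lhs => rw [← Submodule.map_id K]
    congr 1
    ext x
    simp
  obtain ⟨v, hvdef⟩ : ∃ v, v = G (T.symm (bP (Sum.inl (Sum.inl PUnit.unit)))) := ⟨_, rfl⟩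
  have hGK : Submodule.map G K =
      Submodule.span ℤ (insert v (Set.range fun j => bP (Sum.inl (Sum.inr j)))) := by
    rw [hK, ← Submodule.map_comp, Submodule.map_span, range_comp_inl_eq_insert, Set.image_insert_eq,
      ← Set.range_comp]
    have hfun : ((G ∘ₗ (T.symm.toLinearEquiv : _ →ₗ[ℤ] _)) ∘ fun j => bP (Sum.inl (Sum.inr j))) =
        fun j => bP (Sum.inl (Sum.inr j)) := funext fun j => hGb j
    rw [hfun, hvdef]
    rfl
  -- `v` is isotropic and orthogonal to the `βⱼ`
  have hvv : Q⟦μP⟧ v v = 0 := by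
    rw [hvdef, hGiso, T.symm.map_app, hee]
  have hvβ : ∀ j, Q⟦μP⟧ v (bP (Sum.inl (Sum.inr j))) = 0 := fun j => by
    rw [hvdef, ← hGb j, hGiso, T.symm.map_app, heβ]
  -- `G(K)` is complemented of rank `m + 2`
  obtain ⟨hGKc, -, hGKr⟩ := lagrangian_map_of_bijective G hGbij hGiso1 hKc hKi hKr
  rw [hGK] at hGKc hGKr
  have hr : finrank ℤ (Submodule.span ℤ (insert v (Set.range fun j => bP (Sum.inl (Sum.inr j))))) =
      (m + 1) + 1 := by omega
  -- the dichotomy of spans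
  have htwin := span_insert_eq_or_twin hsymmP hUP bP hee hef hff heβ heβ' hfβ hfβ' hββ hββ' hvβ hvv
    hGKc hr
  refine ⟨φ, gd, hφ, hgd', ?_⟩
  rw [← hGdef, hGK, range_comp_inl_eq_insert]
  exact htwin

end WordMover
/-! ### The graph mover on `P = T # (m+1)(S² × S²)` from (R) for `T # m(S² × S²)`: the dichotomy -/

section GraphMover

/-- **The graph mover for odd forms** (Wall 1964 §2 with Kirby's odd device, Ch. X p. 58, run
WITHOUT realising complex conjugation).  Let `T` be closed simply connected with, for every
orientation, a basis of `H²(T)/T` of Gram matrix `!![0,1;1,1]`; `X` an `m`-fold stabilisation of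
`T`, `P = X # S² × S²` with a core-hyperbolic basis `bP` of `H²(P)/T` for `Q⟦μP⟧`; `N` closed
simply connected with `H²(N)/T = H²(M₁)/T ⊕ H²(M₂)/T`, `Q_N = Q⟦μ⟧ ⊕ (−Q⟦ν⟧)`, an isometry
`α : Q⟦μ⟧ ≅ Q⟦ν⟧`, and a vector `z` of norm `η = ±1` in `Q⟦ν⟧`.  GIVEN (R) (`hR`), for every
`±`-isometric bijection `θ : H²(N)/T → H²(P)/T` one of the graphs of `α`, `α ∘ τ_z`
(`unitReflectionEquiv`) is carried by a diffeomorphism of `P` onto `L = span {e, βⱼ}`.  Proof: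
(R) for `(X, P)` (`Q_X ≅ Q_T ⊕ m·H` is indefinite) gives `Θ : Q ⊕ H ≅ Q_P` with realised conjugated
generators; the `m` planes of `Q_X`, the core `f, e − f` of `Q_T` and `H` exhaust `Q ⊕ H`, so the
odd Lagrangian mover (`exists_wordMover_odd`) carries each graph `Kᵢ` onto `L` or its twin `L̃` by
the diffeomorphism of a WORD `φᵢ`; if both landed on `L̃`, the word `φ₁ φ₂⁻¹` would carry a
characteristic isotropic vector `y₁ ∈ K₁` (`exists_isCharacteristic_mem_graph`) to `k₂ ∈ K₂` with
`4 ∣ y₁·k₂` (`four_dvd_apply_of_isWordIn`), hence `4 ∣ y₁·y₂` along the isotropic `K₂`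
(`four_dvd_iff_of_mem_isotropic`) — contradicting `not_four_dvd_graph_graph_reflection`.
[cite: WallJLMS1964, §2, p. 145] [cite: Kirby1989, Ch. X, proof of Thm. 2 (pp. 58, 61–62)] -/
theorem exists_graphMover_odd
    (hR : ∀ (X : Type) [TopologicalSpace X] [T2Space X] [SecondCountableTopology X]
      [ChartedSpace (𝔼 4) X] [CompactSpace X] [IsManifold (𝓡 4) ∞ X] [SimplyConnectedSpace X]
      (ξ : HomologicalOrientation ℤ X 4)
      (_hX : (Q⟦ξ⟧).IsIndefinite ∨ Module.finrank ℤ ↥(freeCohomology ℤ X 2) ≤ 8)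
      (Y : Type) [TopologicalSpace Y] [T2Space Y] [SecondCountableTopology Y]
      [ChartedSpace (𝔼 4) Y] [CompactSpace Y] [IsManifold (𝓡 4) ∞ Y]
      (_hY : IsConnectedSum (𝓡 4) (𝓡 4) ((𝓡 2).prod (𝓡 2)) X ((𝕊 2) × (𝕊 2)) Y)
      (υ : HomologicalOrientation ℤ Y 4) (V : Type) [AddCommGroup V] (Q : BilinForm ℤ V)
      (hQ : Q.IsSymm) (_e : Q.IsometryEquiv (Q⟦ξ⟧))
      (_Θ₀ : (Q.prod hyperbolicForm).IsometryEquiv (Q⟦υ⟧)),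
      ∃ Θ : (Q.prod hyperbolicForm).IsometryEquiv (Q⟦υ⟧),
        ∀ s ∈ wallGenerators hQ, IsRealisedByDiffeomorph υ (Θ.symm.trans (s.trans Θ)))
    {T : Type} [TopologicalSpace T] [T2Space T] [SecondCountableTopology T]
    [ChartedSpace (𝔼 4) T] [CompactSpace T] [IsManifold (𝓡 4) ∞ T] [SimplyConnectedSpace T]
    (hT : ∀ μT : HomologicalOrientation ℤ T 4, ∃ bT : Basis (Fin 2) ℤ ↥(freeCohomology ℤ T 2),
      Q⟦μT⟧ (bT 0) (bT 0) = 0 ∧ Q⟦μT⟧ (bT 0) (bT 1) = 1 ∧ Q⟦μT⟧ (bT 1) (bT 1) = 1)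
    {m : ℕ} {X : Type} [TopologicalSpace X] [T2Space X] [SecondCountableTopology X]
    [ChartedSpace (𝔼 4) X] [CompactSpace X] [IsManifold (𝓡 4) ∞ X] [SimplyConnectedSpace X]
    (hX : IsStabilization m T X)
    {P : Type} [TopologicalSpace P] [T2Space P] [SecondCountableTopology P]
    [ChartedSpace (𝔼 4) P] [CompactSpace P] [IsManifold (𝓡 4) ∞ P] [SimplyConnectedSpace P]
    (hCS : IsConnectedSum (𝓡 4) (𝓡 4) ((𝓡 2).prod (𝓡 2)) X ((𝕊 2) × (𝕊 2)) P)
    (μP : HomologicalOrientation ℤ P 4)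
    (bP : Basis ((Unit ⊕ Fin (m + 1)) ⊕ (Unit ⊕ Fin (m + 1))) ℤ ↥(freeCohomology ℤ P 2))
    (hee : Q⟦μP⟧ (bP (Sum.inl (Sum.inl PUnit.unit))) (bP (Sum.inl (Sum.inl PUnit.unit))) = 0)
    (hef : Q⟦μP⟧ (bP (Sum.inl (Sum.inl PUnit.unit))) (bP (Sum.inr (Sum.inl PUnit.unit))) = 1)
    (hff : Q⟦μP⟧ (bP (Sum.inr (Sum.inl PUnit.unit))) (bP (Sum.inr (Sum.inl PUnit.unit))) = 1)
    (heβ : ∀ j, Q⟦μP⟧ (bP (Sum.inl (Sum.inl PUnit.unit))) (bP (Sum.inl (Sum.inr j))) = 0)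
    (heβ' : ∀ j, Q⟦μP⟧ (bP (Sum.inl (Sum.inl PUnit.unit))) (bP (Sum.inr (Sum.inr j))) = 0)
    (hfβ : ∀ j, Q⟦μP⟧ (bP (Sum.inr (Sum.inl PUnit.unit))) (bP (Sum.inl (Sum.inr j))) = 0)
    (hfβ' : ∀ j, Q⟦μP⟧ (bP (Sum.inr (Sum.inl PUnit.unit))) (bP (Sum.inr (Sum.inr j))) = 0)
    (hββ : ∀ i j, Q⟦μP⟧ (bP (Sum.inl (Sum.inr i))) (bP (Sum.inl (Sum.inr j))) = 0)
    (hβ'β' : ∀ i j, Q⟦μP⟧ (bP (Sum.inr (Sum.inr i))) (bP (Sum.inr (Sum.inr j))) = 0)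
    (hββ' : ∀ i j, Q⟦μP⟧ (bP (Sum.inl (Sum.inr i))) (bP (Sum.inr (Sum.inr j))) = if i = j then 1 else 0)
    {M₁ M₂ N : Type} [TopologicalSpace M₁] [T2Space M₁] [SecondCountableTopology M₁]
    [ChartedSpace (𝔼 4) M₁] [CompactSpace M₁] [IsManifold (𝓡 4) ∞ M₁] [SimplyConnectedSpace M₁]
    [TopologicalSpace M₂] [T2Space M₂] [SecondCountableTopology M₂]
    [ChartedSpace (𝔼 4) M₂] [CompactSpace M₂] [IsManifold (𝓡 4) ∞ M₂] [SimplyConnectedSpace M₂]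
    [TopologicalSpace N] [CompactSpace N] [T2Space N] [ChartedSpace (𝔼 4) N] [SimplyConnectedSpace N]
    (μ : HomologicalOrientation ℤ M₁ 4) (ν : HomologicalOrientation ℤ M₂ 4)
    (π : HomologicalOrientation ℤ N 4)
    {sM : ↥(freeCohomology ℤ N 2) →ₗ[ℤ] ↥(freeCohomology ℤ M₁ 2)}
    {sN : ↥(freeCohomology ℤ N 2) →ₗ[ℤ] ↥(freeCohomology ℤ M₂ 2)}
    (hst : Function.Bijective fun x => (sM x, sN x))
    (hQN : ∀ x y, Q⟦π⟧ x y = Q⟦μ⟧ (sM x) (sM y) - Q⟦ν⟧ (sN x) (sN y))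
    (α : (Q⟦μ⟧).IsometryEquiv (Q⟦ν⟧)) {z : ↥(freeCohomology ℤ M₂ 2)} {η : ℤ}
    (hz : Q⟦ν⟧ z z = η) (hη : η * η = 1)
    (βo : HomologicalOrientation ℤ P 4)
    (θ : ↥(freeCohomology ℤ N 2) →ₗ[ℤ] ↥(freeCohomology ℤ P 2)) (hθ : Function.Bijective θ)
    (hθf : ∃ d : ℤ, (d = 1 ∨ d = -1) ∧ ∀ x y, Q⟦βo⟧ (θ x) (θ y) = d * Q⟦π⟧ x y) :
    ∃ (e : (Q⟦μ⟧).IsometryEquiv (Q⟦ν⟧)) (g : P ≃ₘ⟮𝓡 4, 𝓡 4⟯ P),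
      Submodule.map (freeCohomology.map (R := ℤ) (⟨g, g.continuous⟩ : C(P, P)) 2)
        (Submodule.map θ (graphSubmodule sM sN (e : ↥(freeCohomology ℤ M₁ 2) →ₗ[ℤ] ↥(freeCohomology ℤ M₂ 2)))) =
        Submodule.span ℤ (Set.range (bP ∘ Sum.inl)) := by
  classical
  -- the lattices of `P`, `M₁`, `M₂`
  obtain ⟨hfinP, hfreeP⟩ := finite_and_free_freeCohomology_two (M := P)
  obtain ⟨hfinM, hfreeM⟩ := finite_and_free_freeCohomology_two (M := M₁)
  obtain ⟨hfinM₂, hfreeM₂⟩ := finite_and_free_freeCohomology_two (M := M₂)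
  haveI := hfinP
  haveI := hfreeP
  haveI := hfinM
  haveI := hfreeM
  haveI := hfinM₂
  haveI := hfreeM₂
  have hsymmP : (Q⟦μP⟧).IsSymm :=
    isSymm_intersectionForm (cupProduct_gradedComm_holds ℤ P) even_two two_add_two_eq_four μP
  have hUP : (Q⟦μP⟧).IsUnimodular := isPerfPair_intersectionForm_four_of_compactSpace (M := P) μP
  have hsymmμ : (Q⟦μ⟧).IsSymm :=
    isSymm_intersectionForm (cupProduct_gradedComm_holds ℤ M₁) even_two two_add_two_eq_four μ
  have hUμ : (Q⟦μ⟧).IsUnimodular := isPerfPair_intersectionForm_four_of_compactSpace (M := M₁) μ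
  have hsymmν : (Q⟦ν⟧).IsSymm :=
    isSymm_intersectionForm (cupProduct_gradedComm_holds ℤ M₂) even_two two_add_two_eq_four ν
  -- `θ` is a `±`-isometry into `Q⟦μP⟧` (`βo = ±μP`)
  obtain ⟨d, hd, hdform⟩ := hθf
  obtain ⟨d', hd', hθ'⟩ : ∃ d' : ℤ, (d' = 1 ∨ d' = -1) ∧ ∀ x y, Q⟦μP⟧ (θ x) (θ y) = d' * Q⟦π⟧ x y := by
    rcases HomologicalOrientation.eq_or_eq_neg_of_connected_holds P βo μP with h | h
    · exact ⟨d, hd, fun x y => by rw [← h]; exact hdform x y⟩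
    · refine ⟨-d, ?_, fun x y => ?_⟩
      · rcases hd with rfl | rfl
        · right; rfl
        · left; norm_num
      · have h1 := hdform x y
        rw [h, intersectionForm_neg (HomologicalOrientation.fundamentalClass_neg_holds ℤ P 4)
          two_add_two_eq_four μP, LinearMap.neg_apply, LinearMap.neg_apply] at h1
        linear_combination -h1
  -- the lattice data of `P = X # S² × S²` (one-fold) and of `X = T # m(S² × S²)`
  obtain ⟨ξ₀⟩ := isOrientableOver_of_simplyConnectedSpace ℤ X (n := 4)
  obtain ⟨μT₀⟩ := isOrientableOver_of_simplyConnectedSpace ℤ T (n := 4)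
  have h1 : IsStabilization 1 X P := (isStabilization_zero_self X).succ hCS
  obtain ⟨-, -, -, hdata1⟩ := exists_stabilisationCobordism 1 X P h1
  obtain ⟨-, -, Θone, -, ξ₁, -, -, -, -, -, -, -, hΘone⟩ := hdata1 ξ₀ μP
  obtain ⟨-, -, -, hdataX⟩ := exists_stabilisationCobordism m T X hX
  obtain ⟨-, -, ΘX, -, μT', -, -, -, -, -, -, -, hΘX⟩ := hdataX μT₀ ξ₁
  obtain ⟨bT, hT00, hT01, hT11⟩ := hT μT'
  have hsymmT : (Q⟦μT'⟧).IsSymm :=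
    isSymm_intersectionForm (cupProduct_gradedComm_holds ℤ T) even_two two_add_two_eq_four μT'
  have hΘX0 : ∀ c c' : Fin m → Fin 2 → ℤ,
      Q⟦ξ₁⟧ (ΘX (0, c)) (ΘX (0, c')) = ∑ j, hyperbolicForm (c j) (c' j) := fun c c' => by
    rw [hΘX]
    simp
  have hΘXc0 : ∀ (a : ↥(freeCohomology ℤ T 2)) (c : Fin m → Fin 2 → ℤ),
      Q⟦ξ₁⟧ (ΘX (a, 0)) (ΘX (0, c)) = 0 := fun a c => by
    rw [hΘX]
    simp
  have hΘX00 : ∀ a a' : ↥(freeCohomology ℤ T 2), Q⟦ξ₁⟧ (ΘX (a, 0)) (ΘX (a', 0)) = Q⟦μT'⟧ a a' :=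
    fun a a' => by
    rw [hΘX]
    simp
  have hqq' : Q⟦μT'⟧ (bT 0 - bT 1) (bT 0 - bT 1) = -1 := by
    simp only [map_sub, LinearMap.sub_apply, hT00, hT01, hT11, hsymmT.eq (bT 1) (bT 0)]
    norm_num
  have hpq' : Q⟦μT'⟧ (bT 1) (bT 0 - bT 1) = 0 := by
    simp only [map_sub, hT01, hT11, hsymmT.eq (bT 1) (bT 0), sub_self]
  -- the lattice of `X`: `Q_X ≅ Q_T ⊕ m·H` is indefinite and unimodular
  obtain ⟨hfinX, hfreeX⟩ := finite_and_free_freeCohomology_two (M := X)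
  haveI := hfinX
  haveI := hfreeX
  have hXind : (Q⟦ξ₁⟧).IsIndefinite ∨ Module.finrank ℤ ↥(freeCohomology ℤ X 2) ≤ 8 := by
    left
    refine LinearMap.BilinForm.isIndefinite_of_apply_self_neg_of_pos (x := ΘX (bT 0 - bT 1, 0))
      (y := ΘX (bT 1, 0)) ?_ ?_
    · rw [hΘX00, hqq']; norm_num
    · rw [hΘX00, hT11]; norm_num
  have hsymmX : (Q⟦ξ₁⟧).IsSymm :=
    isSymm_intersectionForm (cupProduct_gradedComm_holds ℤ X) even_two two_add_two_eq_four ξ₁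
  have hUX : (Q⟦ξ₁⟧).IsUnimodular := isPerfPair_intersectionForm_four_of_compactSpace (M := X) ξ₁
  -- a full basis of `H²(X)/T` adapted to `ΘX`
  obtain ⟨bXf, hbXf1, hbXf2, hbXf3⟩ := exists_coreBasis_of_stabilisationData ΘX bT
  /- an abstract copy `(V, Q)` of the lattice `Q_X` (coordinates in a basis, as an opaque
  additive group), as in `HCobordismKirbyRealisation.lean` -/
  obtain ⟨V, instV, g, Q, hQg⟩ : ∃ (V : Type) (_ : AddCommGroup V)
      (g : V ≃+ ↥(freeCohomology ℤ X 2)) (Q : BilinForm ℤ V), ∀ a b, Q a b = Q⟦ξ₁⟧ (g a) (g b) :=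
    ⟨(Module.Free.ChooseBasisIndex ℤ ↥(freeCohomology ℤ X 2) → ℤ), inferInstance,
      (Module.Free.chooseBasis ℤ ↥(freeCohomology ℤ X 2)).equivFun.symm.toAddEquiv,
      (Q⟦ξ₁⟧).comp (Module.Free.chooseBasis ℤ ↥(freeCohomology ℤ X 2)).equivFun.symm.toLinearMap
        (Module.Free.chooseBasis ℤ ↥(freeCohomology ℤ X 2)).equivFun.symm.toLinearMap,
      fun a b => LinearMap.BilinForm.comp_apply _ _ _ a b⟩
  have hQe : ∀ a b, Q (g.symm a) (g.symm b) = Q⟦ξ₁⟧ a b := fun a b => by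
    simp only [hQg, AddEquiv.apply_symm_apply]
  have hQ' : Q.IsSymm := ⟨fun a b => by simp only [hQg]; exact hsymmX.eq _ _⟩
  let Lg : V ≃ₗ[ℤ] ↥(freeCohomology ℤ X 2) :=
    { g with
      map_smul' := fun c x => by
        simpa only [Int.cast_id, RingHom.id_apply, AddEquiv.coe_toAddMonoidHom,
          AddEquiv.toFun_eq_coe] using map_intCast_smul g.toAddMonoidHom ℤ ℤ c x }
  let eIso : Q.IsometryEquiv (Q⟦ξ₁⟧) :=
    { Lg with
      map_app' := fun a b => by
        change Q⟦ξ₁⟧ (g a) (g b) = Q a b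
        exact (hQg a b).symm }
  obtain ⟨Θ₀⟩ := nonempty_isometryEquiv_of_stabilisationForm_one ξ₁ μP Θone hΘone Q g
    fun a b => (hQg a b).symm
  -- (R) for `P = X # S² × S²`
  obtain ⟨Θ, hSΘ⟩ := hR X ξ₁ hXind P hCS μP V Q hQ' eIso Θ₀
  -- the target data in `Q ⊕ H`: the `m` planes of `Q_X`, the core `pV = f`, `qV = e - f`
  set xs : Fin m → V × (Fin 2 → ℤ) := fun j => (g.symm (ΘX (0, Pi.single j (Pi.single 0 1))), 0)
    with hxs
  set ys : Fin m → V × (Fin 2 → ℤ) := fun j => (g.symm (ΘX (0, Pi.single j (Pi.single 1 1))), 0)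
    with hys
  have hvv : ∀ (a b : Fin 2) (i j : Fin m),
      Q.prod hyperbolicForm ((g.symm (ΘX (0, Pi.single i (Pi.single a 1))), 0))
          ((g.symm (ΘX (0, Pi.single j (Pi.single b 1))), 0)) =
        if i = j then hyperbolicForm (Pi.single a 1 : Fin 2 → ℤ) (Pi.single b 1) else 0 := by
    intro a b i j
    rw [prod_hyperbolic_inl_inl, hQe, hΘX0, sum_hyperbolicForm_single_single]
  have hxx : ∀ i j, Q.prod hyperbolicForm (xs i) (xs j) = 0 := fun i j => by
    rw [hxs, hvv, hyperbolicForm_single_zero_self, ite_self]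
  have hyy : ∀ i j, Q.prod hyperbolicForm (ys i) (ys j) = 0 := fun i j => by
    rw [hys, hvv, hyperbolicForm_single_one_self, ite_self]
  have hxy : ∀ i j, Q.prod hyperbolicForm (xs i) (ys j) = if i = j then 1 else 0 := fun i j => by
    rw [hxs, hys, hvv, hyperbolicForm_single_zero_single_one]
  have hxX : ∀ j, Q.prod hyperbolicForm (xs j) hypX = 0 := fun j => prod_hyperbolic_inl_hypX Q _
  have hxY : ∀ j, Q.prod hyperbolicForm (xs j) hypY = 0 := fun j => prod_hyperbolic_inl_hypY Q _
  have hyX : ∀ j, Q.prod hyperbolicForm (ys j) hypX = 0 := fun j => prod_hyperbolic_inl_hypX Q _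
  have hyY : ∀ j, Q.prod hyperbolicForm (ys j) hypY = 0 := fun j => prod_hyperbolic_inl_hypY Q _
  set pV : V := g.symm (ΘX (bT 1, 0)) with hpV
  set qV : V := g.symm (ΘX (bT 0 - bT 1, 0)) with hqV
  have hpp : Q pV pV = 1 := by rw [hpV, hQe, hΘX00, hT11]
  have hqq : Q qV qV = -1 := by rw [hqV, hQe, hΘX00, hqq']
  have hpq : Q pV qV = 0 := by rw [hpV, hqV, hQe, hΘX00, hpq']
  have hpx : ∀ j, Q.prod hyperbolicForm ((pV, 0) : V × (Fin 2 → ℤ)) (xs j) = 0 := fun j => by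
    rw [hxs, prod_hyperbolic_inl_inl, hpV, hQe, hΘXc0]
  have hpy : ∀ j, Q.prod hyperbolicForm ((pV, 0) : V × (Fin 2 → ℤ)) (ys j) = 0 := fun j => by
    rw [hys, prod_hyperbolic_inl_inl, hpV, hQe, hΘXc0]
  have hqx : ∀ j, Q.prod hyperbolicForm ((qV, 0) : V × (Fin 2 → ℤ)) (xs j) = 0 := fun j => by
    rw [hxs, prod_hyperbolic_inl_inl, hqV, hQe, hΘXc0]
  have hqy : ∀ j, Q.prod hyperbolicForm ((qV, 0) : V × (Fin 2 → ℤ)) (ys j) = 0 := fun j => by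
    rw [hys, prod_hyperbolic_inl_inl, hqV, hQe, hΘXc0]
  -- the planes, the core and `H` exhaust `Q ⊕ H`
  have hspan : ∀ v : V × (Fin 2 → ℤ), (∀ j, Q.prod hyperbolicForm v (xs j) = 0) →
      (∀ j, Q.prod hyperbolicForm v (ys j) = 0) → Q.prod hyperbolicForm v hypX = 0 →
      Q.prod hyperbolicForm v hypY = 0 → Q.prod hyperbolicForm v ((pV, 0) : V × (Fin 2 → ℤ)) = 0 →
      Q.prod hyperbolicForm v ((qV, 0) : V × (Fin 2 → ℤ)) = 0 → v = 0 := by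
    intro v hvx hvy hvX hvY hvp hvq
    have hv : v = (v.1, 0) := eq_inl_fst_of_ortho_hyp hvX hvY
    have hB : (Q.prod hyperbolicForm).IsSymm := hQ'.prod isSymm_hyperbolicForm
    -- `Q v₁ w = 0` for `w = pV, qV, (xs j).1, (ys j).1`
    have hvp' : Q v.1 pV = 0 := by rw [← prod_hyperbolic_inl_inl (Q := Q), ← hv]; exact hvp
    have hvq' : Q v.1 qV = 0 := by rw [← prod_hyperbolic_inl_inl (Q := Q), ← hv]; exact hvq
    -- the functional `Q_X (g v₁)` vanishes on the basis `bXf`, hence everywhere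
    have hzero : Q⟦ξ₁⟧ (g v.1) = 0 := by
      refine bXf.ext fun idx => ?_
      rw [LinearMap.zero_apply]
      rcases idx with i | (j | j)
      · rw [hbXf1]
        revert i
        refine Fin.forall_fin_two.2 ⟨?_, ?_⟩
        · have hsplit : ΘX (bT 0, 0) = ΘX (bT 1, 0) + ΘX (bT 0 - bT 1, 0) := by
            rw [← map_add, Prod.mk_add_mk, add_zero, add_sub_cancel]
          rw [hsplit, map_add, ← g.apply_symm_apply (ΘX (bT 1, 0)),
            ← g.apply_symm_apply (ΘX (bT 0 - bT 1, 0)), ← hQg, ← hQg, ← hpV, ← hqV, hvp', hvq',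
            add_zero]
        · rw [← g.apply_symm_apply (ΘX (bT 1, 0)), ← hQg, ← hpV, hvp']
      · rw [hbXf2, ← hQe, g.symm_apply_apply, ← prod_hyperbolic_inl_inl (Q := Q), ← hv]
        exact hvx j
      · rw [hbXf3, ← hQe, g.symm_apply_apply, ← prod_hyperbolic_inl_inl (Q := Q), ← hv]
        exact hvy j
    have hv1 : v.1 = 0 := by
      haveI : (Q⟦ξ₁⟧).IsPerfPair := hUX
      have h := (LinearMap.IsPerfPair.bijective_left (Q⟦ξ₁⟧)).1 (hzero.trans (map_zero _).symm)
      rw [← g.symm_apply_apply v.1, h, map_zero]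
    rw [hv, hv1]
    rfl
  -- the two graphs `K₁ = θ(graph α)`, `K₂ = θ(graph (α ∘ τ))` are Lagrangian direct summands
  have hlag : ∀ e' : (Q⟦μ⟧).IsometryEquiv (Q⟦ν⟧),
      (∃ K', IsCompl (Submodule.map θ (graphSubmodule sM sN (e' : _ →ₗ[ℤ] _))) K') ∧
      (∀ x ∈ Submodule.map θ (graphSubmodule sM sN (e' : _ →ₗ[ℤ] _)),
        ∀ y ∈ Submodule.map θ (graphSubmodule sM sN (e' : _ →ₗ[ℤ] _)), Q⟦μP⟧ x y = 0) ∧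
      2 * finrank ℤ (Submodule.map θ (graphSubmodule sM sN (e' : _ →ₗ[ℤ] _))) =
        finrank ℤ ↥(freeCohomology ℤ P 2) := fun e' => by
    obtain ⟨hc, hi, hr⟩ := graphSubmodule_lagrangian hst hQN e'
    exact lagrangian_map_of_bijective θ hθ hθ' hc hi hr
  -- the word movers of both graphs
  obtain ⟨φ₁, g₁, hφ₁, hg₁, h₁⟩ := exists_wordMover_odd hQ' hxx hyy hxy hxX hxY hyX hyY hpp hqq hpq
    hpx hpy hqx hqy hspan μP Θ hSΘ bP hee hef hff heβ heβ' hfβ hfβ' hββ hβ'β' hββ' _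
    (hlag α).1 (hlag α).2.1 (hlag α).2.2
  rcases h₁ with h₁ | h₁
  · exact ⟨α, g₁, h₁⟩
  let τ := unitReflectionEquiv hsymmν z η hz hη
  obtain ⟨φ₂, g₂, hφ₂, hg₂, h₂⟩ := exists_wordMover_odd hQ' hxx hyy hxy hxX hxY hyX hyY hpp hqq hpq
    hpx hpy hqx hqy hspan μP Θ hSΘ bP hee hef hff heβ heβ' hfβ hfβ' hββ hβ'β' hββ' _
    (hlag (α.trans τ)).1 (hlag (α.trans τ)).2.1 (hlag (α.trans τ)).2.2
  rcases h₂ with h₂ | h₂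
  · exact ⟨α.trans τ, g₂, h₂⟩
  -- both graphs land on the twin: contradiction with the parity invariant
  exfalso
  obtain ⟨w, hw⟩ := exists_isCharacteristic_of_module hsymmμ hUμ
  obtain ⟨x₁, hsx₁, htx₁, hx₁c, hx₁0⟩ := exists_isCharacteristic_mem_graph hst hQN α hw
  obtain ⟨x₂, hsx₂, htx₂, hx₂c, hx₂0⟩ := exists_isCharacteristic_mem_graph hst hQN (α.trans τ) hw
  have hnot : ¬ (4 : ℤ) ∣ Q⟦π⟧ x₁ x₂ :=
    not_four_dvd_graph_graph_reflection hQN hsymmν α hz hη hw hsx₁ htx₁ hsx₂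
      (by rw [htx₂, LinearMap.BilinForm.IsometryEquiv.trans_apply])
  have hx₁K : x₁ ∈ graphSubmodule sM sN (α : _ →ₗ[ℤ] _) :=
    (mem_graphSubmodule_iff _ _).2 (by rw [hsx₁, htx₁]; rfl)
  have hx₂K : x₂ ∈ graphSubmodule sM sN ((α.trans τ : (Q⟦μ⟧).IsometryEquiv (Q⟦ν⟧)) : _ →ₗ[ℤ] _) :=
    (mem_graphSubmodule_iff _ _).2 (by rw [hsx₂, htx₂]; rfl)
  -- transport to `P` along `θ`
  have hy₁c : (Q⟦μP⟧).IsCharacteristic (θ x₁) := isCharacteristic_of_surjective θ hθ.2 d' hθ' hx₁c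
  have hy₂c : (Q⟦μP⟧).IsCharacteristic (θ x₂) := isCharacteristic_of_surjective θ hθ.2 d' hθ' hx₂c
  have hy₁0 : Q⟦μP⟧ (θ x₁) (θ x₁) = 0 := by rw [hθ', hx₁0, mul_zero]
  have hy₂K : θ x₂ ∈ Submodule.map θ (graphSubmodule sM sN ((α.trans τ : (Q⟦μ⟧).IsometryEquiv (Q⟦ν⟧)) : _ →ₗ[ℤ] _)) :=
    Submodule.mem_map_of_mem hx₂K
  have hnot' : ¬ (4 : ℤ) ∣ Q⟦μP⟧ (θ x₁) (θ x₂) := by rwa [four_dvd_map_iff θ d' hd' hθ']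
  -- `g₁^* y₁ ∈ g₁^*(K₁) = L̃ = g₂^*(K₂)`: a `k₂ ∈ K₂` with `g₂^* k₂ = g₁^* y₁`
  have hmem : freeCohomology.map (R := ℤ) (⟨g₁, g₁.continuous⟩ : C(P, P)) 2 (θ x₁) ∈
      Submodule.map (freeCohomology.map (R := ℤ) (⟨g₂, g₂.continuous⟩ : C(P, P)) 2)
        (Submodule.map θ (graphSubmodule sM sN ((α.trans τ : (Q⟦μ⟧).IsometryEquiv (Q⟦ν⟧)) : _ →ₗ[ℤ] _))) := by
    rw [h₂, ← h₁]
    exact Submodule.mem_map_of_mem (Submodule.mem_map_of_mem hx₁K)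
  obtain ⟨k₂, hk₂K, hk₂⟩ := hmem
  rw [hg₁, hg₂] at hk₂
  have hk₂' : k₂ = Θ (φ₂.symm (φ₁ (Θ.symm (θ x₁)))) := by
    have h := congrArg φ₂.symm (Θ.injective hk₂)
    rw [LinearMap.BilinForm.IsometryEquiv.symm_apply_apply] at h
    rw [← h, LinearMap.BilinForm.IsometryEquiv.apply_symm_apply]
  -- the parity invariant of the word `φ₁ φ₂⁻¹`
  have hψ : IsWordIn (wallGenerators hQ') (φ₁.trans φ₂.symm) := hφ₁.trans hφ₂.symm
  obtain ⟨u₁, hu₁⟩ : ∃ u₁, u₁ = Θ.symm (θ x₁) := ⟨_, rfl⟩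
  have hu₁c : (Q.prod hyperbolicForm).IsCharacteristic u₁ := by
    rw [hu₁]
    exact isCharacteristic_of_surjective (Θ.symm.toLinearEquiv : _ →ₗ[ℤ] _)
      Θ.symm.toLinearEquiv.surjective 1 (fun a b => by rw [one_mul]; exact Θ.symm.map_app b a) hy₁c
  have hu₁0 : Q.prod hyperbolicForm u₁ u₁ = 0 := by rw [hu₁, Θ.symm.map_app, hy₁0]
  have h4 : (4 : ℤ) ∣ Q.prod hyperbolicForm u₁ ((φ₁.trans φ₂.symm) u₁) :=
    four_dvd_apply_of_isWordIn hQ' hψ hu₁c hu₁0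
  have hpair : Q⟦μP⟧ (θ x₁) k₂ = Q.prod hyperbolicForm u₁ ((φ₁.trans φ₂.symm) u₁) := by
    rw [← Θ.map_app ((φ₁.trans φ₂.symm) u₁) u₁, LinearMap.BilinForm.IsometryEquiv.trans_apply, hu₁,
      LinearMap.BilinForm.IsometryEquiv.apply_symm_apply, ← hk₂']
  have h4' : (4 : ℤ) ∣ Q⟦μP⟧ (θ x₁) k₂ := by rw [hpair]; exact h4
  have hk₂c : (Q⟦μP⟧).IsCharacteristic k₂ := by
    rw [hk₂', ← LinearMap.BilinForm.IsometryEquiv.trans_apply φ₁ φ₂.symm, ← hu₁]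
    exact (hu₁c.map (φ₁.trans φ₂.symm)).map Θ
  -- constancy of the relation along the isotropic `K₂`
  have hiff := four_dvd_iff_of_mem_isotropic hUP (hlag (α.trans τ)).2.1 hy₁c hy₂c hk₂c hy₂K hk₂K
  exact hnot' (hiff.2 h4')

end GraphMover

/-! ### The standard filling of `P = T # (m+1)(S² × S²)` over the twisted filling of `T` -/

section OddFilling

/-- **The filling `V = V_T ∪_T E` of `P = T # (m+1)(S² × S²)` with its laws**, for `T = ∂V_T` the
boundary of a compact simply connected `V_T` onto whose `H₂` it maps, with the per-orientation
basis/dying data of `exists_twistedFilling`: `E : T ∼ P` with its Kronecker data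
(`exists_stabilisationCobordism_kronecker`) attached to `V_T` (`exists_cobordismAttachment_holds`,
Milnor 1965 Thm. 1.4); `V` is simply connected (van Kampen); (i) `H₂(P) → H₂(V)` onto
(Mayer–Vietoris, `H₁(T) = 0`); (ii) the basis `bT` of Gram `!![0,1;1,1]` for the orientation `μT`
of the form law; (iii) every `y ∈ H₂(P)` orthogonal to the `βⱼ` and to `Θ(bT 0, 0)` dies in `V`
(it comes from `w ∈ H₂(T)` with `⟨bT 0, w⟩ = 0`, which dies in `V_T`); (iv) the form law
`Q_P (Θ x) (Θ y) = Q_T x₁ y₁ + Σ H(x₂ⱼ, y₂ⱼ)`. [cite: WallJLMS1964, §2 pp. 144–146]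
[cite: Kirby1989, Ch. X pp. 55–56] [cite: MilnorHCobordism1965, §1 Thm. 1.4] -/
theorem exists_oddStandardFilling (m : ℕ) {W₀ : Type} [TopologicalSpace W₀] [T2Space W₀]
    [SecondCountableTopology W₀] [ChartedSpace (EuclideanHalfSpace (4 + 1)) W₀]
    [IsManifold (𝓡∂ (4 + 1)) ∞ W₀] [CompactSpace W₀] [SimplyConnectedSpace W₀]
    (bW : BoundaryData (𝓡∂ (4 + 1)) W₀ (𝓡 4)) [T2Space bW.carrier]
    [SecondCountableTopology bW.carrier] [CompactSpace bW.carrier] [SimplyConnectedSpace bW.carrier]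
    (hTbasis : ∀ μ : HomologicalOrientation ℤ bW.carrier 4,
      ∃ bT : Basis (Fin 2) ℤ ↥(freeCohomology ℤ bW.carrier 2),
        Q⟦μ⟧ (bT 0) (bT 0) = 0 ∧ Q⟦μ⟧ (bT 0) (bT 1) = 1 ∧ Q⟦μ⟧ (bT 1) (bT 1) = 1 ∧
        ∀ y : singularHomology ℤ ℤ bW.carrier 2, freeKroneckerPairing bW.carrier 2 (bT 0) y = 0 →
          singularHomology.map ℤ ℤ bW.inclC 2 y = 0)
    (hTepi : Epi (singularHomology.map ℤ ℤ bW.inclC 2))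
    (P : Type) [TopologicalSpace P] [T2Space P] [SecondCountableTopology P] [ChartedSpace (𝔼 4) P]
    [CompactSpace P] [IsManifold (𝓡 4) ∞ P] (hP : IsStabilization (m + 1) bW.carrier P)
    (μP : HomologicalOrientation ℤ P 4) :
    ∃ (V : Type) (_ : TopologicalSpace V) (_ : T2Space V) (_ : SecondCountableTopology V)
      (_ : ChartedSpace (EuclideanHalfSpace (4 + 1)) V) (_ : IsManifold (𝓡∂ (4 + 1)) ∞ V)
      (_ : CompactSpace V) (_ : SimplyConnectedSpace V)
      (ι : P → V) (hι : Manifold.IsSmoothEmbedding (𝓡 4) (𝓡∂ (4 + 1)) ∞ ι)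
      (_ : range ι = (𝓡∂ (4 + 1)).boundary V)
      (Θ : (↥(freeCohomology ℤ bW.carrier 2) × (Fin (m + 1) → Fin 2 → ℤ)) ≃+ ↥(freeCohomology ℤ P 2))
      (μT : HomologicalOrientation ℤ bW.carrier 4) (bT : Basis (Fin 2) ℤ ↥(freeCohomology ℤ bW.carrier 2)),
      Epi (singularHomology.map ℤ ℤ (⟨ι, hι.isEmbedding.continuous⟩ : C(P, V)) 2) ∧
      (Q⟦μT⟧ (bT 0) (bT 0) = 0 ∧ Q⟦μT⟧ (bT 0) (bT 1) = 1 ∧ Q⟦μT⟧ (bT 1) (bT 1) = 1) ∧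
      (∀ y : singularHomology ℤ ℤ P 2,
        (∀ j, freeKroneckerPairing P 2 (Θ (0, Pi.single j (Pi.single 0 1))) y = 0) →
        freeKroneckerPairing P 2 (Θ (bT 0, 0)) y = 0 →
        singularHomology.map ℤ ℤ (⟨ι, hι.isEmbedding.continuous⟩ : C(P, V)) 2 y = 0) ∧
      (∀ x y, Q⟦μP⟧ (Θ x) (Θ y) = Q⟦μT⟧ x.1 y.1 + ∑ j, hyperbolicForm (x.2 j) (y.2 j)) := by
  -- the stabilisation cobordism with its lattice data
  obtain ⟨hPsc, -, -, hdata⟩ := exists_stabilisationCobordism_kronecker (m + 1) bW.carrier P hP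
  haveI := hPsc
  obtain ⟨μT₀⟩ := isOrientableOver_of_simplyConnectedSpace ℤ bW.carrier (n := 4)
  obtain ⟨E, b, Θ, ε, μT, hEsc, hEepi, -, -, -, hP2K, -, hP4⟩ := hdata μT₀ μP
  haveI := hEsc
  obtain ⟨bT, h00, h01, h11, hTdie⟩ := hTbasis μT
  -- attach `E` to `W₀` along `∂W₀ = T`
  obtain ⟨V, i1, i2, i3, i4, i5, ⟨At⟩⟩ := exists_cobordismAttachment_holds 3 W₀ bW
    bW.carrier P E (Diffeomorph.refl (𝓡 4) bW.carrier ∞)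
  haveI : CompactSpace V := At.compactSpace
  haveI : SimplyConnectedSpace V := At.simplyConnectedSpace
  -- `jX_* : H₂(E) → H₂(V)` is onto (`H₁(T) = 0`, `H₂(T) → H₂(W₀)` onto)
  haveI : Epi (singularHomology.map ℤ ℤ bW.inclC (1 + 1)) := hTepi
  have h1T : IsZero (singularHomology ℤ ℤ bW.carrier 1) :=
    isZero_singularHomology_one_of_simplyConnectedSpace ℤ ℤ
  have hepiJ : Epi (singularHomology.map ℤ ℤ At.jXC (1 + 1)) := At.epi_map_jX_of_epi ℤ ℤ h1T
  have hfac : (⟨At.jX ∘ E.inr, At.isSmoothEmbedding_jX_comp_inr.isEmbedding.continuous⟩ : C(P, V)) =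
      At.jXC.comp ⟨E.inr, E.continuous_inr⟩ := rfl
  -- the seam: `jX ∘ inl = jW ∘ incl`
  have hseam : (At.jXC.comp ⟨E.inl, E.continuous_inl⟩ : C(bW.carrier, V)) = At.jWC.comp bW.inclC := by
    ext t
    change At.jX (E.inl t) = At.jW (bW.incl t)
    rw [At.jW_incl]
    rfl
  refine ⟨V, i1, i2, i3, i4, i5, ‹_›, ‹_›, At.jX ∘ E.inr, At.isSmoothEmbedding_jX_comp_inr,
    At.range_jX_comp_inr, Θ, μT, bT, ?_, ⟨h00, h01, h11⟩, fun y hyβ hy0 => ?_, hP4⟩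
  · rw [hfac, singularHomology.map_comp]
    haveI := hEepi
    haveI := hepiJ
    apply epi_comp
  · -- `y ⊥ βⱼ`: `inr_* y = inl_* w` with `⟨bT 0, w⟩ = ⟨Θ(bT 0, 0), y⟩ = 0`, and `w` dies in `W₀`
    obtain ⟨w, hw, hwpair⟩ := hP2K y hyβ
    have hw0 : singularHomology.map ℤ ℤ bW.inclC 2 w = 0 :=
      hTdie w (by rw [← hwpair]; exact hy0)
    rw [hfac, singularHomology.map_comp, ModuleCat.comp_apply, hw, ← ModuleCat.comp_apply,
      ← singularHomology.map_comp, hseam, singularHomology.map_comp, ModuleCat.comp_apply, hw0,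
      map_zero]

end OddFilling
/-! ### Wall's §2 assembly over the odd model (abstract `T`, `X`, `P`) -/

section Assembly

/-- **Wall's Theorem 2 for odd forms over an abstract odd core-free model.**  Data: (R); Thom's
theorem; closed simply connected `M`, `N` with an isometry `α : Q⟦μ⟧ ≅ Q⟦ν⟧`, `Q⟦μ⟧` odd of rank
`m + 2`, a vector of norm `±1` in `Q⟦ν⟧`; a compact simply connected `V_T` with boundary datum
`bW` (boundary `T`) carrying the per-orientation basis/dying data of `exists_twistedFilling` and
`H₂(T) → H₂(V_T)` onto; an `m`-fold stabilisation `X` of `T` and `P = X # S² × S²` (closed simply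
connected).  Conclusion: `M`, `N` are h-cobordant.  Proof — the filling clause of
`isHCobordant_of_wallFilling_of_graphMover` over `∂V = P`, `V = V_T ∪ E`
(`exists_oddStandardFilling`): the core-hyperbolic basis (`exists_oddCoreBasis`), the detector
`π₀ = (⟨bP (inl a), ·⟩)ₐ` (dying law (iii)), `Ann (ker π₀) ⊆ L = span {e, βⱼ}`
(`mem_span_sumInl_of_forall_kronecker`), the h-cobordism `N′ ∼ P` for `N′ = M # (−N)`
(`exists_isometryEquiv_of_splitting_of_not_isEven` + the (R)-theorem for odd forms WITH a
hyperbolic pair, `isHCobordant_of_equivalent_intersectionForm_of_not_isEven_of_realisedWallGenerators`),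
and the graph mover (`exists_graphMover_odd`). [cite: WallJLMS1964, Thm. 2 and §2 pp. 144–146]
[cite: Kirby1989, Ch. X, proofs of Thm. 1 (pp. 55–56) and Thm. 2 (pp. 58, 61–62)] -/
theorem isHCobordant_of_not_isEven_of_oddModel
    (hR : ∀ (X : Type) [TopologicalSpace X] [T2Space X] [SecondCountableTopology X]
      [ChartedSpace (𝔼 4) X] [CompactSpace X] [IsManifold (𝓡 4) ∞ X] [SimplyConnectedSpace X]
      (ξ : HomologicalOrientation ℤ X 4)
      (_hX : (Q⟦ξ⟧).IsIndefinite ∨ Module.finrank ℤ ↥(freeCohomology ℤ X 2) ≤ 8)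
      (Y : Type) [TopologicalSpace Y] [T2Space Y] [SecondCountableTopology Y]
      [ChartedSpace (𝔼 4) Y] [CompactSpace Y] [IsManifold (𝓡 4) ∞ Y]
      (_hY : IsConnectedSum (𝓡 4) (𝓡 4) ((𝓡 2).prod (𝓡 2)) X ((𝕊 2) × (𝕊 2)) Y)
      (υ : HomologicalOrientation ℤ Y 4) (V : Type) [AddCommGroup V] (Q : BilinForm ℤ V)
      (hQ : Q.IsSymm) (_e : Q.IsometryEquiv (Q⟦ξ⟧))
      (_Θ₀ : (Q.prod hyperbolicForm).IsometryEquiv (Q⟦υ⟧)),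
      ∃ Θ : (Q.prod hyperbolicForm).IsometryEquiv (Q⟦υ⟧),
        ∀ s ∈ wallGenerators hQ, IsRealisedByDiffeomorph υ (Θ.symm.trans (s.trans Θ)))
    (h2 : isOrientedBordant_of_signature_eq.{0})
    {M N : Type} [TopologicalSpace M] [T2Space M] [SecondCountableTopology M]
    [ChartedSpace (𝔼 4) M] [CompactSpace M] [IsManifold (𝓡 4) ∞ M] [SimplyConnectedSpace M]
    [TopologicalSpace N] [T2Space N] [SecondCountableTopology N]
    [ChartedSpace (𝔼 4) N] [CompactSpace N] [IsManifold (𝓡 4) ∞ N] [SimplyConnectedSpace N]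
    (μ : HomologicalOrientation ℤ M 4) (ν : HomologicalOrientation ℤ N 4)
    (α : (Q⟦μ⟧).IsometryEquiv (Q⟦ν⟧)) (hodd : ¬ (Q⟦μ⟧).IsEven)
    {z : ↥(freeCohomology ℤ N 2)} {η : ℤ} (hz : Q⟦ν⟧ z z = η) (hη : η * η = 1)
    {m : ℕ} (hm : Module.finrank ℤ ↥(freeCohomology ℤ M 2) = (m + 1) + 1)
    {W₀ : Type} [TopologicalSpace W₀] [T2Space W₀] [SecondCountableTopology W₀]
    [ChartedSpace (EuclideanHalfSpace (4 + 1)) W₀] [IsManifold (𝓡∂ (4 + 1)) ∞ W₀] [CompactSpace W₀]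
    [SimplyConnectedSpace W₀]
    (bW : BoundaryData (𝓡∂ (4 + 1)) W₀ (𝓡 4)) [T2Space bW.carrier]
    [SecondCountableTopology bW.carrier] [CompactSpace bW.carrier] [SimplyConnectedSpace bW.carrier]
    (hTbasis : ∀ μT : HomologicalOrientation ℤ bW.carrier 4,
      ∃ bT : Basis (Fin 2) ℤ ↥(freeCohomology ℤ bW.carrier 2),
        Q⟦μT⟧ (bT 0) (bT 0) = 0 ∧ Q⟦μT⟧ (bT 0) (bT 1) = 1 ∧ Q⟦μT⟧ (bT 1) (bT 1) = 1 ∧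
        ∀ y : singularHomology ℤ ℤ bW.carrier 2, freeKroneckerPairing bW.carrier 2 (bT 0) y = 0 →
          singularHomology.map ℤ ℤ bW.inclC 2 y = 0)
    (hTepi : Epi (singularHomology.map ℤ ℤ bW.inclC 2))
    {X : Type} [TopologicalSpace X] [T2Space X] [SecondCountableTopology X]
    [ChartedSpace (𝔼 4) X] [CompactSpace X] [IsManifold (𝓡 4) ∞ X] [SimplyConnectedSpace X]
    (hX : IsStabilization m bW.carrier X)
    {P : Type} [TopologicalSpace P] [T2Space P] [SecondCountableTopology P]
    [ChartedSpace (𝔼 4) P] [CompactSpace P] [IsManifold (𝓡 4) ∞ P] [SimplyConnectedSpace P]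
    (hCS : IsConnectedSum (𝓡 4) (𝓡 4) ((𝓡 2).prod (𝓡 2)) X ((𝕊 2) × (𝕊 2)) P) :
    IsHCobordant 4 M N := by
  classical
  have hP : IsStabilization (m + 1) bW.carrier P := hX.succ hCS
  obtain ⟨μP⟩ := isOrientableOver_of_simplyConnectedSpace ℤ P (n := 4)
  -- the filling of `P` with its laws, and the core-hyperbolic basis of `H²(P)/T`
  obtain ⟨V, i1, i2, i3, i4, i5, i6, hVsc, ι, hι, hιr, Θ, μT, bT, hepi, ⟨hT00, hT01, hT11⟩, hker,
    hform⟩ := exists_oddStandardFilling m bW hTbasis hTepi P hP μP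
  obtain ⟨bP, hee, hef, hff, heβ, heβ', hfβ, hfβ', hββ, hβ'β', hββ', hbPe, hbPβ⟩ :=
    exists_oddCoreBasis μP μT Θ hform bT hT00 hT01 hT11
  have hTbasis' : ∀ μT : HomologicalOrientation ℤ bW.carrier 4,
      ∃ bT : Basis (Fin 2) ℤ ↥(freeCohomology ℤ bW.carrier 2),
        Q⟦μT⟧ (bT 0) (bT 0) = 0 ∧ Q⟦μT⟧ (bT 0) (bT 1) = 1 ∧ Q⟦μT⟧ (bT 1) (bT 1) = 1 := fun μT' =>
    (hTbasis μT').imp fun _ h => ⟨h.1, h.2.1, h.2.2.1⟩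
  -- the lattices of `M`, `N`, `P`
  obtain ⟨hfinM, hfreeM⟩ := finite_and_free_freeCohomology_two (M := M)
  obtain ⟨hfinN, hfreeN⟩ := finite_and_free_freeCohomology_two (M := N)
  haveI := hfinM
  haveI := hfreeM
  haveI := hfinN
  haveI := hfreeN
  have hsymmP : (Q⟦μP⟧).IsSymm :=
    isSymm_intersectionForm (cupProduct_gradedComm_holds ℤ P) even_two two_add_two_eq_four μP
  refine isHCobordant_of_wallFilling_of_graphMover M N μ ν
    (fun N' _ _ _ _ _ _ _ π sM sN hst hQ' => ?_)
  -- the h-cobordism `N' ∼ P`: `Q_{N'} ≅ !![0,1;1,1] ⊕ (m+1)·H = Q_P`, odd, with a hyperbolic pair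
  obtain ⟨⟨e⟩, hoddN', hcore⟩ := exists_isometryEquiv_of_splitting_of_not_isEven μ ν π hst hQ' α
    hodd hsymmP hm bP hee hef hff heβ heβ' hfβ hfβ' hββ hβ'β' hββ'
  obtain ⟨e₀, f₀, he₀, hf₀, hef₀⟩ := hcore (Nat.succ_pos m)
  obtain ⟨Chc, hChc⟩ :=
    isHCobordant_of_equivalent_intersectionForm_of_not_isEven_of_realisedWallGenerators hR h2 π μP
      ⟨e⟩ hoddN' ⟨e₀, f₀, he₀, hf₀, hef₀⟩
  -- the boundary datum `∂V = P`, the detector `π₀` and the sub-Lagrangian `L = span {e, βⱼ}`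
  let bV : BoundaryData (𝓡∂ (4 + 1)) V (𝓡 4) :=
    { carrier := P
      incl := ι
      isSmoothEmbedding := hι
      range_incl := hιr }
  let π₀ : singularHomology ℤ ℤ P 2 →ₗ[ℤ] (Unit ⊕ Fin (m + 1) → ℤ) :=
    LinearMap.pi fun a => freeKroneckerPairing P 2 (bP (Sum.inl a))
  have hπ₀ : ∀ y, π₀ y = 0 ↔ ∀ a, freeKroneckerPairing P 2 (bP (Sum.inl a)) y = 0 := fun y =>
    ⟨fun h a => congrFun h a, fun h => funext h⟩
  refine ⟨V, i1, i2, i3, i4, i5, i6, hVsc, bV, inferInstance, inferInstance, Chc,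
    (Unit ⊕ Fin (m + 1) → ℤ), inferInstance, inferInstance, inferInstance, π₀,
    Submodule.span ℤ (Set.range (bP ∘ Sum.inl)), hChc, hepi, fun y hy => ?_, fun c hc => ?_,
    fun βo θ hθ hθf => ?_⟩
  · -- `ker π₀` dies in `V`
    refine hker y (fun j => ?_) ?_
    · rw [← hbPβ]; exact (hπ₀ y).1 hy (Sum.inr j)
    · rw [← hbPe PUnit.unit]; exact (hπ₀ y).1 hy (Sum.inl PUnit.unit)
  · -- `Ann (ker π₀) ⊆ L`
    exact mem_span_sumInl_of_forall_kronecker bP c fun y hy => hc y ((hπ₀ y).2 hy)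
  · -- the graph mover
    exact exists_graphMover_odd hR hTbasis' hX hCS μP bP hee hef hff heβ heβ' hfβ hfβ' hββ hβ'β'
      hββ' μ ν π hst hQ' α hz hη βo θ hθ hθf

end Assembly

/-! ### Wall's Theorem 2 for odd forms of rank `≥ 2` representing `±1`, from (R) -/

section Main

/-- **Wall's Theorem 2 for ODD forms of rank `≥ 2` whose form represents `1` or `-1`, from the
realisation (R) of Kirby's generators of one `S² × S²` summand and Thom's theorem alone** — WALL'S
TRICK FOR ODD FORMS.  For closed smooth simply connected `M`, `N` with `Q⟦μ⟧ ≅ Q⟦ν⟧` odd of rank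
`≥ 2` and a class of square `±1` in `H²(N)/T` (every odd indefinite form — e.g. the Akhmedov–Park
form `⟨1⟩ ⊕ 2⟨-1⟩` — and `±I_n`), `M` and `N` are h-cobordant, GIVEN (R) (`hR`, implied by
Thm. X.2: `realisedWallGenerators_of_thmX2`) and Thom's `Ω₄^SO ≅ ℤ` (`h2`).  The odd core-free
model is the twisted filling of `S² ×~ S²` (`exists_twistedFilling`), stabilised
(`exists_isStabilization`, `StdChart.isConnectedSum_top`); the assembly is
`isHCobordant_of_not_isEven_of_oddModel`.  No hyperbolic pair in `Q⟦μ⟧`, no generation theorem for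
`O(Q ⊕ H)` and no realised complex conjugation are used.
[cite: WallJLMS1964, Thm. 2 (p. 141) and §2 pp. 144–146]
[cite: Kirby1989, Ch. X, proofs of Thm. 1 (pp. 55–56) and Thm. 2 (pp. 58, 61–62)] -/
theorem isHCobordant_of_equivalent_intersectionForm_of_not_isEven_of_realisedWallGenerators'
    (hR : ∀ (X : Type) [TopologicalSpace X] [T2Space X] [SecondCountableTopology X]
      [ChartedSpace (𝔼 4) X] [CompactSpace X] [IsManifold (𝓡 4) ∞ X] [SimplyConnectedSpace X]
      (ξ : HomologicalOrientation ℤ X 4)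
      (_hX : (Q⟦ξ⟧).IsIndefinite ∨ Module.finrank ℤ ↥(freeCohomology ℤ X 2) ≤ 8)
      (Y : Type) [TopologicalSpace Y] [T2Space Y] [SecondCountableTopology Y]
      [ChartedSpace (𝔼 4) Y] [CompactSpace Y] [IsManifold (𝓡 4) ∞ Y]
      (_hY : IsConnectedSum (𝓡 4) (𝓡 4) ((𝓡 2).prod (𝓡 2)) X ((𝕊 2) × (𝕊 2)) Y)
      (υ : HomologicalOrientation ℤ Y 4) (V : Type) [AddCommGroup V] (Q : BilinForm ℤ V)
      (hQ : Q.IsSymm) (_e : Q.IsometryEquiv (Q⟦ξ⟧))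
      (_Θ₀ : (Q.prod hyperbolicForm).IsometryEquiv (Q⟦υ⟧)),
      ∃ Θ : (Q.prod hyperbolicForm).IsometryEquiv (Q⟦υ⟧),
        ∀ s ∈ wallGenerators hQ, IsRealisedByDiffeomorph υ (Θ.symm.trans (s.trans Θ)))
    (h2 : isOrientedBordant_of_signature_eq.{0})
    {M N : Type} [TopologicalSpace M] [T2Space M] [SecondCountableTopology M]
    [ChartedSpace (𝔼 4) M] [CompactSpace M] [IsManifold (𝓡 4) ∞ M] [SimplyConnectedSpace M]
    [TopologicalSpace N] [T2Space N] [SecondCountableTopology N]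
    [ChartedSpace (𝔼 4) N] [CompactSpace N] [IsManifold (𝓡 4) ∞ N] [SimplyConnectedSpace N]
    (μ : HomologicalOrientation ℤ M 4) (ν : HomologicalOrientation ℤ N 4)
    (hQ : (Q⟦μ⟧).Equivalent (Q⟦ν⟧)) (hodd : ¬ (Q⟦μ⟧).IsEven)
    (hunit : ∃ z : ↥(freeCohomology ℤ N 2), Q⟦ν⟧ z z = 1 ∨ Q⟦ν⟧ z z = -1)
    (h2le : 2 ≤ Module.finrank ℤ ↥(freeCohomology ℤ M 2)) : IsHCobordant 4 M N := by
  classical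
  obtain ⟨m, hm⟩ : ∃ m, Module.finrank ℤ ↥(freeCohomology ℤ M 2) = (m + 1) + 1 :=
    ⟨Module.finrank ℤ ↥(freeCohomology ℤ M 2) - 2, by omega⟩
  obtain ⟨α⟩ := hQ
  obtain ⟨z, hz⟩ := hunit
  -- the odd core-free model `T = S² ×~ S²` with its filling
  obtain ⟨W₀, _, _, _, _, _, _, _, bW, _, _, _, _, hTbasis, hTepi⟩ := exists_twistedFilling
  -- `X = T # m(S² × S²)`, `P = X # S² × S²`
  obtain ⟨X, _, _, _, _, _, _, _, hX⟩ := exists_isStabilization m bW.carrier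
  obtain ⟨C, -, -⟩ := StdChart.exists_mem_source (Classical.arbitrary X)
  have hP : IsStabilization (m + 1) bW.carrier C.Top := hX.succ C.isConnectedSum_top
  obtain ⟨hPsc, hPc, hP2, -⟩ := exists_stabilisationCobordism (m + 1) bW.carrier C.Top hP
  haveI := hPsc
  haveI := hPc
  haveI := hP2
  rcases hz with hz | hz
  · exact isHCobordant_of_not_isEven_of_oddModel hR h2 μ ν α hodd hz (one_mul 1) hm bW hTbasis hTepi
      hX C.isConnectedSum_top
  · exact isHCobordant_of_not_isEven_of_oddModel hR h2 μ ν α hodd hz (by norm_num) hm bW hTbasis hTepi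
      hX C.isConnectedSum_top

/-- **Wall's Theorem 2 for odd forms of rank `≥ 2` representing `±1`, from Kirby's Thm. X.2 and
Thom's theorem** (X.2 — `exists_diffeomorph_freeCohomologyMap_eq_of_isometryEquiv`, the Wall
diffeomorphisms seat's fact — implies (R): `realisedWallGenerators_of_thmX2`).
[cite: WallJLMS1964, Thm. 2 (p. 141)] [cite: Kirby1989, Ch. X, Thm. 2 (p. 58)] -/
theorem isHCobordant_of_equivalent_intersectionForm_of_not_isEven_of_thmX2'
    (h1 : exists_diffeomorph_freeCohomologyMap_eq_of_isometryEquiv)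
    (h2 : isOrientedBordant_of_signature_eq.{0})
    {M N : Type} [TopologicalSpace M] [T2Space M] [SecondCountableTopology M]
    [ChartedSpace (𝔼 4) M] [CompactSpace M] [IsManifold (𝓡 4) ∞ M] [SimplyConnectedSpace M]
    [TopologicalSpace N] [T2Space N] [SecondCountableTopology N]
    [ChartedSpace (𝔼 4) N] [CompactSpace N] [IsManifold (𝓡 4) ∞ N] [SimplyConnectedSpace N]
    (μ : HomologicalOrientation ℤ M 4) (ν : HomologicalOrientation ℤ N 4)
    (hQ : (Q⟦μ⟧).Equivalent (Q⟦ν⟧)) (hodd : ¬ (Q⟦μ⟧).IsEven)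
    (hunit : ∃ z : ↥(freeCohomology ℤ N 2), Q⟦ν⟧ z z = 1 ∨ Q⟦ν⟧ z z = -1)
    (h2le : 2 ≤ Module.finrank ℤ ↥(freeCohomology ℤ M 2)) : IsHCobordant 4 M N :=
  isHCobordant_of_equivalent_intersectionForm_of_not_isEven_of_realisedWallGenerators'
    (realisedWallGenerators_of_thmX2 h1) h2 μ ν hQ hodd hunit h2le

end Main


end Literature.Topology.FourManifolds

end
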